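import Literature.MathematicalPhysics.QuantumFieldTheory.Balaban1983to89.B3GkZeroBoxSeparated
import Literature.MathematicalPhysics.QuantumFieldTheory.Balaban1983to89.B4Delta112ZeroBox

/-!
# `Balaban1983to89.B3DeltaGkZeroNest` — T. Bałaban, *(Higgs)₂,₃ quantum fields in a finite volume. III. Renormalization*,
# Commun. Math. Phys. **88** (1983) 411–445 [Balaban1983Higgs3], (2.5) p. 424: the KERNEL ESTIMATES behind
# `‖h δG_k(Ω,Ω₂,B̃) h′‖_{1,α} ≤ O(e^{−δ₀dist})e^{−δ₀dist(supp h,supp h′)}`, PROVED for the MODEL INSTANCE `A = B̃ = 0`,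
# `Ω₂ = □ ⊂ Ω = □₀` NESTED rectangular parallelepipeds of unit blocks: the zero-field kernel
# `δG_k(Ω,Ω₂,0;x,x′) = G^η_k(□₀,0;x,x′) − G^η_k(□,0;x,x′)` between fine points of `□` whose unit cubes keep a label margin
# `r ≥ 3` from `□₀∖□`, its lattice derivatives in either variable, the Hölder quotients of these derivatives and the mixed
# second differences are ALL `≤ C·e^{−δ₀r}·e^{−δ₀·η|x−x′|_∞}` — REGULAR ON THE DIAGONAL, uniformly in the scale `k ≥ 1`, the
# two boxes and the window

statement-level skeleton of published theorems with citation tags; proofs where landed; nothing here is a claim about the Yang–Mills mass gap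

PDF held: `paper:balaban1983-higgs-2-3-quantum-fields-finite-volume` (journal page = PDF page + 410); p. 414 [PDF 4] (the definition
of `δG_k(Ω,Ω₂,B̃)` and of (1.16)), p. 420 [PDF 10] ((1.32)), p. 424 [PDF 14] ((2.5)–(2.6)), p. 433 [PDF 23] (the two uses of `δG_k`)
read in the OCR text (`p0004.txt`, `p0010.txt`, `p0014.txt`, `p0023.txt`) and on the render
`run/shared/lean/pub/pub-balaban/b2b-balaban-ref1/pages/1983-cmp88-higgs23-III/1983-cmp88-higgs23-III-p014-x2.png`; the cited
source [B4] = T. Bałaban, *Regularity and decay of lattice Green's functions*, Commun. Math. Phys. **89** (1983) 571–597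
[Balaban1983RegularityDecay], p. 573 (1.11)–(1.12) and p. 581 (Cor. 2.3, last sentence), as quoted in `B4Delta112ZeroBox`.

CITATION HEADER (lean-in-tree rule).  Part of the lit-balaban TYPED SKELETON (HOME `run/shared/lean/pub/lit-balaban/`), Phase 2:
SKELETON row **B3.Eq2.5** (`HOME/lit-balaban-r15/ROWS-B3.md`, fold owner r15; decl of record
`B3Sect2StatementsPart2.ScaledKernels.Ineq25`, typed p239134 over the ABSTRACT carrier `ScaledKernels`, status «typed», no proved
member); file 1 of 2 of the member «MODEL INSTANCE A = B̃ = 0, Ω₂ = □ ⊂ Ω = □₀ nested boxes» (file 2, `B3Ineq25ZeroNest`, assembles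
the two-variable norm (1.32) of `h δG_k h′` from the estimates below and discharges `Ineq25` for the concrete carrier); companion of
`B3GkZeroBoxSeparated` / `B3Ineq31ZeroBox` (row B3.Eq3.1, the same programme for `G_k(□,0)` at SEPARATED arguments).

WHAT IS PRINTED.  p. 414 [PDF 4]: *"One of the operations in our procedure is a change of the set Ω. We replace it by another set
Ω₂ ⊂ Ω satisfying the same conditions as Ω, and we replace the propagator G_k(Ω,B̃) by G_k(Ω₂,B̃), so we will have also the
propagators δG_k(Ω,Ω₂,B̃) = G_k(Ω,B̃) − G_k(Ω₂,B̃). … This estimate follows easily from the properties of the propagators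
G_k(Ω,A) proved in the next paper. Also the propagator δG_k(Ω,Ω₂,B̃) will be treated as an external field when the estimates of
perturbative expressions will be considered."*  p. 424 [PDF 14], (2.5): *"At first let us recall that some lines in the graph
correspond to the operators δG_k(Ω,Ω₂,B̃) or (1.16). In the estimates we treat them as external fields and we use the inequalities:
‖h(an operator δG_k(Ω,Ω₂,B̃) or (1.16))h′‖_{1,α} ≤ O(e^{−δ₀dist(Ω₂,∂Ω)} or (e(L^kε)p(L^kε))^{n+n′})e^{−δ₀dist(supp h,supp h′)}, (2.5)
where h, h′ are functions giving the localizations of the vertices."*  [B4] p. 573: *"If Ω ⊂ Ω₀, then for δG_k(Ω,Ω₀,A) defined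
by the equality δG_k(Ω,Ω₀,A) = G_k(Ω,A) − G_k(Ω₀,A), (1.11) we have the inequalities [(1.9), (1.10)] (with the same restrictions
on x, x′) with the additional factor exp(−δ₀dist(supp f,Ω^c) − δ₀dist(supp f,Ω^c)) (1.12) … For some simple sets Ω, e.g. for
rectangular parallelepipeds, the inequalities hold without any restrictions on the points x, x′"*; p. 581: *"The same inequalities
hold for δG_k(Ω,Ω₀,A) with the additional factor e^{−δ₀(dist(supp f,Ω^c) + dist(supp f′,Ω^c))}."*

WHAT IS REPRODUCED (kind «model-instance», G.1 of `HOME/PHASE2-TARGETS.md`).  For the two-variable field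
`(x,x′) ↦ h(x)δG_k(Ω,Ω₂,0;x,x′)h′(x′)` with `h, h′` indicators of unit cubes of `Ω₂ = □` at label margin `r` from `Ω∖Ω₂ = □₀∖□`, the
norm (1.32) "of many variables" needs `sup|δG_k|`, the derivatives in BOTH variables, their Hölder quotients and the mixed second
difference — here at ARBITRARY pairs of such cubes (coincident cubes included: unlike `G_k`, the kernel `δG_k` is regular on the
diagonal away from `Ω∖Ω₂`).  All of these are obtained in the counting normalisation of the `A = 0` box lineage
(`G^η_k = η^{−(d+1)}G_k`, `η^{−1} = L^k =: n`, `G_k(□,0) = Gfine ℓ k M k a m2 = (boxOpR n a_k m² M)⁻¹` on the inner fine box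
`X = Π[0,nM)`, `G_k(□₀,0) = Gfine ℓ k M₀ k a m2` on the outer fine box `X₀ = Π[0,nM₀)`, `□ = s + Π[0,M) ⊂ □₀ = Π[0,M₀)` via
`B4TwoBox120.Fits M M₀ s` and the translation `emb : x ↦ x + ns`):
* §1 label/fine-distance bookkeeping (`supNorm_blk_sub_blk_le`: fine distance `≤ mn` ⇒ label distance `≤ m`; the lower block bound);
* §2 the LABEL MARGIN `Margin n hs r x` («every fine point of `□₀` off the translated `□` has block label at sup-distance `≥ r + 1`
  from the label of `x`», i.e. `dist(□(v), Ω∖Ω₂) ≥ r` for the unit cube `□(v) ∋ x`), and its consequences: such points are off the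
  collar `B4Delta112ZeroBox.Bd` of the cutoff (`not_bd_of_margin`, margin `≥ 2`; their lattice neighbours too for margin `≥ 3`), and
  collar points together with their whole block are at fine distance `≥ n(r − 2)` from them (`sep_of_margin_bd`);
* §3 the kernel `dK n A m2 hs x x′ = G₀(x+ns, x′+ns) − G(x,x′)` (B3's orientation `G_k(Ω) − G_k(Ω₂)`; symmetric, `dK_comm`) and
  **THE REPRESENTATION** (`kf_eq`, from the cutoff–commutator identity `B4Delta112ZeroBox.deltaG_decomp` with the cutoff `χ` of
  that file): for a source `f` supported where `χ = 1` and a point `x` with `χ(x) = 1`,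
  `(G₀E f)(x+ns) − (Gf)(x) = −(G₀ E [H(□),χ] G f)(x+ns)` (`E` = extension by zero); with `f = δ_{x′}` this is `dK(x,x′)`, with
  `f = n(δ_{x′+e_ν} − δ_{x′})` the column difference `n(dK(x,x′+e_ν) − dK(x,x′))` (`dK_eq_kf`, `colDiff_eq_kf`);
* §4 the commutator `[H(□),χ]u` is a first-order operator living on the collar: `|[H,χ]u(z)| ≤ 16(d+1)·B_∂ + (64(d+1) + a_k)·B_val`
  from bounds `B_val` on `u` over the block of `z` and `B_∂` on `n∇u` over the bonds at `z` (`abs_comm_le`, the (C1)/(C2) bounds of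
  the cutoff), and `= 0` off the collar (`comm_eq_zero_of_not_bd`);
* §5 the COLUMN SIDE, pointwise: for `u = G(·,x′)` (resp. `u = n(G(·,x′+e_ν) − G(·,x′))`) and `x′` of margin `r ≥ 3`, the
  separated-argument kernel clauses of the inner box — value / row derivative (resp. column derivative / mixed) — hold on every
  collar block at separation `≥ n/2`, whence `|[H,χ]u(z)| ≤ n^{−(d+1)}·K·e^{2δ}e^{−(δ/2)r}e^{−(δ/2)|z−x′|_∞/n}` for ALL `z`
  (`abs_comm_col_le`, `abs_comm_colDiff_le`);
* §6 the ROW SIDE, weighted `ℓ¹`: the outer Green's function's weighted row bounds (values, differenced rows, Hölder-differenced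
  rows) paired against §5 (`abs_sum_mul_le_of_wt`, the triangle inequality in the exponent) give the four CORE CLAUSES
  `core_value`, `core_rowDiff`, `core_rowHolder`, `core_mixed`, each `≤ C·e^{−(δ/2)r}·e^{−(δ/2)|x−x′|_∞/n}` (Hölder: decay in
  `min(|x₁−x′|,|x₂−x′|)`), with explicit constants;
* §7 the SIX KERNEL CLAUSES of `δG_k(Ω,Ω₂,0)` for the instance, each `∃ δ₀ C > 0 ∀ k ≥ 1, window, nested boxes, r ≥ 3, points of
  margin r`: **`abs_dGk_le`** (value), **`abs_dGkDiff_le`** / **`abs_dGkDiff'_le`** (row / column derivative),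
  **`abs_dGkDD_le`** / **`abs_dGkDD'_le`** (Hölder quotient of the row derivative in the row variable / of the column derivative in
  the column variable, per `0 ≤ α < 1`), **`abs_dGkMixed_le`** (mixed second difference) — fed by `B4Thm110ZeroBox.thm110_zero_box_roww`,
  `B4Thm110ZeroBoxDeriv.thm110_zero_box_deriv_roww`, `B4Thm19ZeroBoxHolder.thm19_zero_box_holder_roww` (outer box) and
  `B3GkZeroBoxSeparated.abs_Gk_sep_le` / `abs_GkDiff_sep_le` / `abs_GkDiff'_sep_le` / `abs_GkMixed_sep_le` at `ρ = 1/2` (inner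
  box); the column-side clauses follow from the row-side ones by the symmetry `dK_comm` — so NO Hölder continuity of a mixed
  derivative is ever needed;
* §8 a non-vacuity witness (a genuinely nested pair with points of margin 3).

HONEST SCOPE / DECLARED DIVERGENCES (F7).  (i) Only `A = B̃ = 0` (`U ≡ 1`, one component), `Ω₂ = □` AND `Ω = □₀` block-aligned
rectangular parallelepipeds with Neumann conditions, `Ω₂ ⊂ Ω` (the print: general `Ω₂ ⊂ Ω` "satisfying the same conditions as Ω",
`B̃` regular; p. 433 also uses `δG_k(□, ηℤ^d, 0)` with the LARGER set second and unbounded — not covered: both boxes are finite);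
all `k ≥ 1`, running constants in a window `[a₋,a₊] × [0,m²₊]`; the operator (1.16) is not treated here (at `Ã = 0` it vanishes for
`n + n′ ≥ 1`, [Balaban1982Higgs1] (3.44): `V_k(0,B̃) = 0`).  (ii) Points: fine points of `Ω₂` whose unit cubes are at label
sup-distance `≥ r + 1` from every unit cube of `Ω∖Ω₂`, `r ≥ 3` (three unit cubes of margin; the print's localizations sit at distance
`r(L^kε) → ∞`, p. 433); derivatives = forward differences along bonds of `□` in the stated variable.  (iii) Sup norm for distances
([Balaban1982Higgs1] (1.3) prints the sup-distance on `T_ε`).  (iv) Constants existential, depending on `d`, `L`, the window (and `α`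
for the Hölder clauses, as printed for the cited Proposition I.2.1: «c₀ on α also»); rates not optimised (`δ₀ = ½·min` of seven
lineage rates).  (v) This file does NOT yet speak about `‖·‖_{1,α}`, localization functions or the carrier `ScaledKernels` — that
assembly is file 2; here only the kernel inequalities.  (vi) READING (GAPS G-B3-p03g6-01, owner r15): the first factor of (2.5) is
printed `e^{−δ₀dist(Ω₂,∂Ω)}`; the cited [B4] (1.12)/Cor. 2.3 and [Balaban1982Higgs1] (2.26) print the distance OF THE LOCALIZATIONS to
the complement of the smaller region, which is what is proved here (`e^{−δ₀r}`, `r` the label margin).  (vii) ROUTE = the print's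
(«follows easily from the properties of the propagators G_k(Ω,A) proved in the next paper») in the form: cutoff–commutator
representation of `δG_k` (kernel-proved in `B4Delta112ZeroBox`, NOT [B4]'s random-walk cancellation p. 579) + the outer box's weighted
row bounds ([B4] (1.10)/(1.9) at `A = 0`, `B4Thm110ZeroBox(Deriv)`, `B4Thm19ZeroBoxHolder`) + the inner box's separated kernel
clauses (`B3GkZeroBoxSeparated` ← (2.6) + (2.10)/(2.11)); used BY NAME; theorems and plain `def`s of real-valued kernels/predicates
only, no `structure`, no Literature fact minted; standard axioms.  Value = kernel certificate of a located by-reference step of B3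
for the zero-background nested-box instance, NOT summit progress.
Unit `lit-balaban-p03-g6` (Phase-2 proof seat p03, gen 6); HOME `run/shared/lean/pub/lit-balaban/` (row B3.Eq2.5, FILED.md, STATUS.md).
-/

namespace Literature.MathematicalPhysics.QuantumFieldTheory.Balaban1983to89.B3DeltaGkZeroNest

open Finset Matrix
open Literature.MathematicalPhysics.QuantumFieldTheory.Balaban1983to89.B4ContourShift (supNorm supNorm_nonneg
  abs_le_supNorm exists_supNorm_eq)
open Literature.MathematicalPhysics.QuantumFieldTheory.Balaban1983to89.B4TorusKernel (supNorm_neg)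
open Literature.MathematicalPhysics.QuantumFieldTheory.Balaban1983to89.B4Lower18 (supNorm_sub_le_one_of_mem_nbrs)
open Literature.MathematicalPhysics.QuantumFieldTheory.Balaban1983to89.B4TwoRegion120 (supNorm_sub_comm)
open Literature.MathematicalPhysics.QuantumFieldTheory.Balaban1983to89.B4Reflection242
open Literature.MathematicalPhysics.QuantumFieldTheory.Balaban1983to89.B4BoxCov237
open Literature.MathematicalPhysics.QuantumFieldTheory.Balaban1983to89.B4Green242Bridge (boxNbrs boxBlk mem_boxBlk_self)
open Literature.MathematicalPhysics.QuantumFieldTheory.Balaban1983to89.B4TwoBox120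
open Literature.MathematicalPhysics.QuantumFieldTheory.Balaban1983to89.B4Thm110ZeroBox
open Literature.MathematicalPhysics.QuantumFieldTheory.Balaban1983to89.B4Thm110ZeroBoxDeriv
open Literature.MathematicalPhysics.QuantumFieldTheory.Balaban1983to89.B4Thm19ZeroBoxHolder
open Literature.MathematicalPhysics.QuantumFieldTheory.Balaban1983to89.B4Delta112ZeroBox (chi chi_nonneg chi_le_one
  abs_chi_sub_nbr_le abs_lap_chi_le exists_near_of_chi_ne_one chi_eq_zero_of_extNbrs ext_of_not_mem ext_of_mem emb_of_mem
  ext_emb deltaG_decomp comm_eq comm_eq' emb_sub_emb supNorm_sub_le_of_boxBlk card_boxNbrs_le card_boxBlk_eq Bd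
  chi_eq_one_of_not_bd)
open Literature.MathematicalPhysics.QuantumFieldTheory.Balaban1983to89.B3GkZeroBoxSeparated

noncomputable section

variable {d : ℕ}

/-! ## §1 Lattice bookkeeping: block labels versus fine sup-distances -/

/-- kernel: fine points at sup-distance `≤ m·n` have `n`-block labels at sup-distance `≤ m`. [folklore] -/
private theorem supNorm_blk_sub_blk_le {n : ℕ} (hn : 1 ≤ n) (m : ℕ) {a b : Fin (d + 1) → ℤ}
    (h : supNorm (a - b) ≤ (m : ℝ) * n) : supNorm (blk n a - blk n b) ≤ m := by
  have hn0 : (0 : ℤ) < n := by exact_mod_cast hn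
  refine supNorm_le_of_forall fun i => ?_
  have hi : (((|(a - b) i| : ℤ)) : ℝ) ≤ (m : ℝ) * n := (abs_le_supNorm (a - b) i).trans h
  have hi' : |a i - b i| ≤ (m : ℤ) * n := by
    have h1 : (((|a i - b i| : ℤ)) : ℝ) ≤ ((((m : ℤ) * (n : ℤ) : ℤ)) : ℝ) := by
      push_cast
      simpa using hi
    exact_mod_cast h1
  have ea : a i % (n : ℤ) + a i / (n : ℤ) * (n : ℤ) = a i := Int.emod_add_ediv_mul (a i) n
  have eb : b i % (n : ℤ) + b i / (n : ℤ) * (n : ℤ) = b i := Int.emod_add_ediv_mul (b i) n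
  have ra0 : 0 ≤ a i % (n : ℤ) := Int.emod_nonneg (a i) hn0.ne'
  have ra1 : a i % (n : ℤ) < n := Int.emod_lt_of_pos (a i) hn0
  have rb0 : 0 ≤ b i % (n : ℤ) := Int.emod_nonneg (b i) hn0.ne'
  have rb1 : b i % (n : ℤ) < n := Int.emod_lt_of_pos (b i) hn0
  have key : |a i / (n : ℤ) - b i / (n : ℤ)| ≤ m := by
    rw [abs_le] at hi' ⊢
    obtain ⟨h1, h2⟩ := hi'
    constructor
    · by_contra hc
      push Not at hc
      have hc' : a i / (n : ℤ) - b i / (n : ℤ) + 1 ≤ -(m : ℤ) := by omega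
      have hm := mul_le_mul_of_nonneg_right hc' hn0.le
      nlinarith
    · by_contra hc
      push Not at hc
      have hc' : (m : ℤ) + 1 ≤ a i / (n : ℤ) - b i / (n : ℤ) := by omega
      have hm := mul_le_mul_of_nonneg_right hc' hn0.le
      nlinarith
  have h2 : (((|(blk n a - blk n b) i| : ℤ)) : ℝ) ≤ (((m : ℤ)) : ℝ) := by
    have : |(blk n a - blk n b) i| ≤ (m : ℤ) := by simpa [blk] using key
    exact_mod_cast this
  simpa using h2

/-- kernel: **points of two `b`-blocks are at least `b(|β − β′|_∞ − 1)` apart** (`β = blk_b x`, `β′ = blk_b x′`) — the lower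
companion of `B4Thm110ZeroBox.supNorm_sub_le_blk` (private copy of `B3Ineq31ZeroBox`'s, private there). [folklore] -/
private theorem blk_sub_le_supNorm_sub {b : ℕ} (hb : 1 ≤ b) (x x' : Fin (d + 1) → ℤ) :
    (b : ℝ) * (supNorm (blk b x - blk b x') - 1) ≤ supNorm (x - x') := by
  have hb0 : (0 : ℤ) < b := by exact_mod_cast hb
  obtain ⟨i, hi⟩ := exists_supNorm_eq (blk b x - blk b x')
  rw [hi]
  have h1 : x i % (b : ℤ) + x i / (b : ℤ) * b = x i := Int.emod_add_ediv_mul (x i) b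
  have h2 : x' i % (b : ℤ) + x' i / (b : ℤ) * b = x' i := Int.emod_add_ediv_mul (x' i) b
  have h3 : 0 ≤ x i % (b : ℤ) := Int.emod_nonneg (x i) hb0.ne'
  have h4 : x i % (b : ℤ) < b := Int.emod_lt_of_pos (x i) hb0
  have h5 : 0 ≤ x' i % (b : ℤ) := Int.emod_nonneg (x' i) hb0.ne'
  have h6 : x' i % (b : ℤ) < b := Int.emod_lt_of_pos (x' i) hb0
  have hβ' : (blk b x - blk b x') i = x i / (b : ℤ) - x' i / (b : ℤ) := rfl
  have h7 : (b : ℤ) * (|x i / (b : ℤ) - x' i / (b : ℤ)| - 1) ≤ |x i - x' i| := by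
    have e : x i - x' i
        = (b : ℤ) * (x i / (b : ℤ) - x' i / (b : ℤ)) + (x i % (b : ℤ) - x' i % (b : ℤ)) := by
      linear_combination -h1 + h2
    rw [e]
    have hr : |x i % (b : ℤ) - x' i % (b : ℤ)| ≤ (b : ℤ) - 1 := by
      rw [abs_le]; constructor <;> omega
    have t := abs_sub_abs_le_abs_sub ((b : ℤ) * (x i / (b : ℤ) - x' i / (b : ℤ))) (-(x i % (b : ℤ) - x' i % (b : ℤ)))
    rw [sub_neg_eq_add, abs_neg, abs_mul, abs_of_pos hb0] at t
    nlinarith [abs_nonneg (x i / (b : ℤ) - x' i / (b : ℤ))]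
  have h8 : (((|x i - x' i| : ℤ)) : ℝ) ≤ supNorm (x - x') := abs_le_supNorm (x - x') i
  have h9 : ((b : ℤ) : ℝ) * ((((|x i / (b : ℤ) - x' i / (b : ℤ)| : ℤ)) : ℝ) - 1) ≤ (((|x i - x' i| : ℤ)) : ℝ) := by
    exact_mod_cast h7
  rw [hβ']
  push_cast at h8 h9 ⊢
  linarith

/-- kernel: the reverse triangle inequality for the lattice sup norm, `|u − w|_∞ − |v − w|_∞ ≤ |u − v|_∞`. [folklore] -/
private theorem supNorm_sub_sub_le (u v w : Fin (d + 1) → ℤ) :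
    supNorm (u - w) - supNorm (v - w) ≤ supNorm (u - v) := by
  have t := supNorm_sub_le_sub_add_sub u v w
  linarith

/-! ## §2 The nested boxes, the label margin of a point, the collar -/

section Setting

variable {n : ℕ} {M M0 : Fin (d + 1) → ℕ} {s : Fin (d + 1) → ℤ}

/-- **THE LABEL MARGIN `r` OF AN INNER FINE POINT `x`** (`Ω₂ = □ ∋ x`, `Ω = □₀`): every fine point `y` of `□₀` that is NOT on the
translated inner box (i.e. `y ∈ Ω∖Ω₂`) has block label at sup-distance `≥ r + 1` from the block label of `x + ns` — equivalently
`dist(□(v), □(w)) ≥ r` for the unit cube `□(v) ∋ x` and every unit cube `□(w) ⊂ Ω∖Ω₂` (`dist` of closed unit cubes in the sup norm =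
`|v − w|_∞ − 1`).  This is the instance's reading of the distance in the first factor of (2.5) ([B4] (1.12): «dist(supp f, Ω^c)»).
[cite: Balaban1983Higgs3, (2.5) p.424] -/
def Margin (n : ℕ) (hs : Fits M M0 s) (r : ℕ) (x : ↥(boxDom (fun i => n * M i))) : Prop :=
  ∀ y : ↥(boxDom (fun i => n * M0 i)), (y.1 - fun i => (n : ℤ) * s i) ∉ boxDom (fun i => n * M i) →
    (r : ℝ) + 1 ≤ supNorm (blk n (emb (hs.scale n) x).1 - blk n y.1)

/-- a larger margin implies a smaller one. [cite: Balaban1983Higgs3, (2.5) p.424] -/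
theorem Margin.mono {hs : Fits M M0 s} {r r' : ℕ} (h : r' ≤ r) {x : ↥(boxDom (fun i => n * M i))}
    (hx : Margin n hs r x) : Margin n hs r' x := by
  intro y hy
  have h1 := hx y hy
  have h2 : (r' : ℝ) ≤ r := by exact_mod_cast h
  linarith

/-- kernel: a point of margin `r ≥ 2` is OFF the collar `Bd` of `B4Delta112ZeroBox` (no point of `Ω∖Ω₂` within fine distance `2n`).
[cite: Balaban1983Higgs3, (2.5) p.424] -/
theorem not_bd_of_margin (hn : 1 ≤ n) (hs : Fits M M0 s) {r : ℕ} (hr : 2 ≤ r) {x : ↥(boxDom (fun i => n * M i))}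
    (hx : Margin n hs r x) : ¬ Bd n hs x := by
  rintro ⟨y, hy, hd⟩
  have h1 := hx y hy
  have h2 : supNorm (blk n (emb (hs.scale n) x).1 - blk n y.1) ≤ (2 : ℕ) :=
    supNorm_blk_sub_blk_le hn 2 (by push_cast; linarith)
  have h3 : (2 : ℝ) ≤ r := by exact_mod_cast hr
  push_cast at h2
  linarith

/-- kernel: a lattice neighbour (inside `□`) of a point of margin `r ≥ 3` is off the collar as well. [cite: Balaban1983Higgs3, (2.5) p.424] -/
theorem not_bd_of_margin_nbr (hn : 1 ≤ n) (hs : Fits M M0 s) {r : ℕ} (hr : 3 ≤ r) {x xe : ↥(boxDom (fun i => n * M i))}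
    (hx : Margin n hs r x) (hxe : supNorm (x.1 - xe.1) ≤ 1) : ¬ Bd n hs xe := by
  rintro ⟨y, hy, hd⟩
  have h1 := hx y hy
  have hn1 : (1 : ℝ) ≤ n := by exact_mod_cast hn
  have t := supNorm_sub_le_sub_add_sub (emb (hs.scale n) x).1 (emb (hs.scale n) xe).1 y.1
  rw [emb_sub_emb hs] at t
  have h2 : supNorm (blk n (emb (hs.scale n) x).1 - blk n y.1) ≤ (3 : ℕ) :=
    supNorm_blk_sub_blk_le hn 3 (by push_cast; nlinarith)
  have h3 : (3 : ℝ) ≤ r := by exact_mod_cast hr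
  push_cast at h2
  linarith

/-- kernel: the cutoff is `1` at a point of margin `r ≥ 2`. [cite: Balaban1983Higgs3, (2.5) p.424] -/
theorem chi_eq_one_of_margin (hn : 2 ≤ n) (hs : Fits M M0 s) (hM : ∀ i, 1 ≤ M i) {r : ℕ} (hr : 2 ≤ r)
    {x : ↥(boxDom (fun i => n * M i))} (hx : Margin n hs r x) : chi n M M0 s x.1 = 1 :=
  chi_eq_one_of_not_bd hn hs hM (z := x) (z' := x) (by rw [sub_self, supNorm_zero']; exact Nat.cast_nonneg n)
    (not_bd_of_margin (by omega) hs hr hx)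

/-- kernel: the cutoff is `1` at a lattice neighbour of a point of margin `r ≥ 3`. [cite: Balaban1983Higgs3, (2.5) p.424] -/
theorem chi_eq_one_of_margin_nbr (hn : 2 ≤ n) (hs : Fits M M0 s) (hM : ∀ i, 1 ≤ M i) {r : ℕ} (hr : 3 ≤ r)
    {x xe : ↥(boxDom (fun i => n * M i))} (hx : Margin n hs r x) (hxe : supNorm (x.1 - xe.1) ≤ 1) :
    chi n M M0 s xe.1 = 1 :=
  chi_eq_one_of_not_bd hn hs hM (z := xe) (z' := xe) (by rw [sub_self, supNorm_zero']; exact Nat.cast_nonneg n)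
    (not_bd_of_margin_nbr (by omega) hs hr hx hxe)

/-- kernel: **COLLAR BLOCKS ARE FAR FROM POINTS OF MARGIN `r`** — if `z` is on the collar and `w` lies in the block of `z`, then
`n(r − 2) ≤ |w − x′|_∞` for every `x′` of margin `r`. [cite: Balaban1983Higgs3, (2.5) p.424] -/
theorem sep_of_margin_bd (hn : 1 ≤ n) (hs : Fits M M0 s) {r : ℕ} {x' z w : ↥(boxDom (fun i => n * M i))}
    (hx' : Margin n hs r x') (hz : Bd n hs z) (hw : blk n w.1 = blk n z.1) :
    (n : ℝ) * ((r : ℝ) - 2) ≤ supNorm (w.1 - x'.1) := by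
  obtain ⟨y, hy, hd⟩ := hz
  have h1 := hx' y hy
  have h2 : supNorm (blk n (emb (hs.scale n) z).1 - blk n y.1) ≤ (2 : ℕ) :=
    supNorm_blk_sub_blk_le hn 2 (by push_cast; linarith)
  push_cast at h2
  have hbw : blk n (emb (hs.scale n) w).1 = blk n (emb (hs.scale n) z).1 := by
    rw [emb_val, emb_val, blk_add_mul hn, blk_add_mul hn, hw]
  have h3 : (r : ℝ) - 1 ≤ supNorm (blk n (emb (hs.scale n) x').1 - blk n (emb (hs.scale n) w).1) := by
    have t := supNorm_sub_sub_le (blk n (emb (hs.scale n) x').1) (blk n (emb (hs.scale n) w).1) (blk n y.1)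
    rw [hbw] at t ⊢
    linarith
  have h4 := blk_sub_le_supNorm_sub hn (emb (hs.scale n) x').1 (emb (hs.scale n) w).1
  rw [emb_sub_emb hs] at h4
  rw [supNorm_sub_comm w.1 x'.1]
  have hn0 : (0 : ℝ) ≤ n := Nat.cast_nonneg n
  have h5 : (n : ℝ) * ((r : ℝ) - 2) ≤ (n : ℝ) * (supNorm (blk n (emb (hs.scale n) x').1 - blk n (emb (hs.scale n) w).1) - 1) :=
    mul_le_mul_of_nonneg_left (by linarith) hn0
  linarith

/-- kernel: the same for a lattice neighbour `w` of a collar point `z`: `n(r − 2) − 1 ≤ |w − x′|_∞`. [cite: Balaban1983Higgs3, (2.5) p.424] -/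
theorem sep_of_margin_bd_nbr (hn : 1 ≤ n) (hs : Fits M M0 s) {r : ℕ} {x' z w : ↥(boxDom (fun i => n * M i))}
    (hx' : Margin n hs r x') (hz : Bd n hs z) (hw : w.1 ∈ nbrs z.1) :
    (n : ℝ) * ((r : ℝ) - 2) - 1 ≤ supNorm (w.1 - x'.1) := by
  have h1 := sep_of_margin_bd hn hs hx' hz (w := z) rfl
  have h2 := supNorm_sub_le_one_of_mem_nbrs hw
  have t := supNorm_sub_le_sub_add_sub z.1 w.1 x'.1
  linarith

end Setting

/-! ## §3 The kernel `δG_k(Ω,Ω₂,0)` of the nested boxes in matrix units and its representation through the cutoff–commutator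
identity -/

section Kernel

variable {n : ℕ} {M M0 : Fin (d + 1) → ℕ} {s : Fin (d + 1) → ℤ}

/-- **`δG_k(Ω,Ω₂,0)(x,x′)` IN MATRIX UNITS** for the nested boxes `Ω₂ = □ = s + Π[0,M) ⊂ Ω = □₀ = Π[0,M₀)` (fine boxes `X`, `X₀`,
`n` points per unit length, coefficient `A` of `aP_k`, mass `m²`): the outer Green's function `(boxOpR n A m² M₀)⁻¹` at the
translated points minus the inner one `(boxOpR n A m² M)⁻¹` — B3's orientation `G_k(Ω,B̃) − G_k(Ω₂,B̃)` (p. 414), the operators read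
on functions on `Ω₂` extended by zero ([B4] (1.11), `B4Delta112ZeroBox.dG` is the opposite sign applied to a source).
[cite: Balaban1983Higgs3, (2.5) p.424] -/
def dK (n : ℕ) (A m2 : ℝ) (hs : Fits M M0 s) (x x' : ↥(boxDom (fun i => n * M i))) : ℝ :=
  (boxOpR n A m2 M0)⁻¹ (emb (hs.scale n) x) (emb (hs.scale n) x') - (boxOpR n A m2 M)⁻¹ x x'

/-- `δG_k(Ω,Ω₂,0)` is a symmetric kernel. [cite: Balaban1983Higgs3, (2.5) p.424] -/
theorem dK_comm (A m2 : ℝ) (hs : Fits M M0 s) (x x' : ↥(boxDom (fun i => n * M i))) :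
    dK n A m2 hs x x' = dK n A m2 hs x' x := by
  unfold dK
  rw [← (boxOpR_inv_isSymm n A m2 M0).apply (emb (hs.scale n) x') (emb (hs.scale n) x),
    ← (boxOpR_inv_isSymm n A m2 M).apply x' x]

/-- The «kernel functional» of a source `f` on the inner box: `(G₀ E f)(x + ns) − (G f)(x)` (`E` = extension by zero), i.e.
`Σ_{x′} δG_k(Ω,Ω₂,0)(x,x′) f(x′)`. [cite: Balaban1983Higgs3, (2.5) p.424] -/
def kf (n : ℕ) (A m2 : ℝ) (hs : Fits M M0 s) (f : ↥(boxDom (fun i => n * M i)) → ℝ)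
    (x : ↥(boxDom (fun i => n * M i))) : ℝ :=
  ((boxOpR n A m2 M0)⁻¹ *ᵥ B4Delta112ZeroBox.ext n M M0 s f) (emb (hs.scale n) x) - ((boxOpR n A m2 M)⁻¹ *ᵥ f) x

/-- the indicator of one inner fine point. [folklore] -/
def ind (x' : ↥(boxDom (fun i => n * M i))) : ↥(boxDom (fun i => n * M i)) → ℝ := fun z => if z = x' then 1 else 0

/-- a matrix applied to the indicator of `x′` is its column `x′`. [folklore] -/
private theorem mulVec_ind (T : Matrix ↥(boxDom (fun i => n * M i)) ↥(boxDom (fun i => n * M i)) ℝ)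
    (x' z : ↥(boxDom (fun i => n * M i))) : (T *ᵥ ind x') z = T z x' := by
  simp only [Matrix.mulVec, dotProduct, ind, mul_ite, mul_one, mul_zero, Finset.sum_ite_eq', Finset.mem_univ, if_true]

/-- the extension by zero of the indicator of `x′` is the indicator of `x′ + ns`. [folklore] -/
private theorem ext_ind (hs : Fits M M0 s) (x' : ↥(boxDom (fun i => n * M i))) (y : ↥(boxDom (fun i => n * M0 i))) :
    B4Delta112ZeroBox.ext n M M0 s (ind x') y = if y = emb (hs.scale n) x' then 1 else 0 := by
  by_cases hy : (y.1 - fun i => (n : ℤ) * s i) ∈ boxDom (fun i => n * M i)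
  · rw [ext_of_mem _ hy, ind]
    have hyz : emb (hs.scale n) ⟨_, hy⟩ = y := emb_of_mem hs hy
    by_cases h : (⟨_, hy⟩ : ↥(boxDom (fun i => n * M i))) = x'
    · rw [if_pos h, if_pos]
      rw [← hyz, h]
    · rw [if_neg h, if_neg]
      intro hyx
      apply h
      apply emb_injective (hs.scale n)
      rw [hyz, hyx]
  · rw [ext_of_not_mem _ hy, if_neg]
    intro hyx
    apply hy
    rw [hyx, emb_val, add_sub_cancel_right]
    exact x'.2

/-- a matrix on the outer box applied to the extended indicator of `x′` is its column `x′ + ns`. [folklore] -/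
private theorem mulVec_ext_ind (hs : Fits M M0 s) (T : Matrix ↥(boxDom (fun i => n * M0 i)) ↥(boxDom (fun i => n * M0 i)) ℝ)
    (x' : ↥(boxDom (fun i => n * M i))) (y : ↥(boxDom (fun i => n * M0 i))) :
    (T *ᵥ B4Delta112ZeroBox.ext n M M0 s (ind x')) y = T y (emb (hs.scale n) x') := by
  have h : B4Delta112ZeroBox.ext n M M0 s (ind x') = fun y' => if y' = emb (hs.scale n) x' then 1 else 0 :=
    funext (ext_ind hs x')
  rw [h]
  simp only [Matrix.mulVec, dotProduct, mul_ite, mul_one, mul_zero, Finset.sum_ite_eq', Finset.mem_univ, if_true]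

/-- **`dK(x,x′)` is the kernel functional of the indicator of `x′`.** [cite: Balaban1983Higgs3, (2.5) p.424] -/
theorem dK_eq_kf (A m2 : ℝ) (hs : Fits M M0 s) (x x' : ↥(boxDom (fun i => n * M i))) :
    dK n A m2 hs x x' = kf n A m2 hs (ind x') x := by
  unfold dK kf
  rw [mulVec_ext_ind hs, mulVec_ind]

/-- the extension by zero is additive. [folklore] -/
private theorem ext_sub (f g : ↥(boxDom (fun i => n * M i)) → ℝ) :
    B4Delta112ZeroBox.ext n M M0 s (f - g) = B4Delta112ZeroBox.ext n M M0 s f - B4Delta112ZeroBox.ext n M M0 s g := by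
  funext y
  simp only [B4Delta112ZeroBox.ext, Pi.sub_apply]
  split_ifs <;> ring

/-- the extension by zero is homogeneous. [folklore] -/
private theorem ext_smul (c : ℝ) (f : ↥(boxDom (fun i => n * M i)) → ℝ) :
    B4Delta112ZeroBox.ext n M M0 s (c • f) = c • B4Delta112ZeroBox.ext n M M0 s f := by
  funext y
  simp only [B4Delta112ZeroBox.ext, Pi.smul_apply, smul_eq_mul]
  split_ifs <;> ring

/-- the kernel functional is linear in the source: differences. [folklore] -/
private theorem kf_sub (A m2 : ℝ) (hs : Fits M M0 s) (f g : ↥(boxDom (fun i => n * M i)) → ℝ)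
    (x : ↥(boxDom (fun i => n * M i))) : kf n A m2 hs (f - g) x = kf n A m2 hs f x - kf n A m2 hs g x := by
  unfold kf
  rw [ext_sub, Matrix.mulVec_sub, Matrix.mulVec_sub]
  simp only [Pi.sub_apply]
  ring

/-- the kernel functional is linear in the source: scalars. [folklore] -/
private theorem kf_smul (A m2 : ℝ) (hs : Fits M M0 s) (c : ℝ) (f : ↥(boxDom (fun i => n * M i)) → ℝ)
    (x : ↥(boxDom (fun i => n * M i))) : kf n A m2 hs (c • f) x = c * kf n A m2 hs f x := by
  unfold kf
  rw [ext_smul, Matrix.mulVec_smul, Matrix.mulVec_smul]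
  simp only [Pi.smul_apply, smul_eq_mul]
  ring

/-- the source `n(δ_{x′+e_ν} − δ_{x′})` of a column difference. [folklore] -/
def indDiff (n : ℕ) (x' xe' : ↥(boxDom (fun i => n * M i))) : ↥(boxDom (fun i => n * M i)) → ℝ :=
  (n : ℝ) • (ind xe' - ind x')

/-- **a column difference of `dK` is the kernel functional of `n(δ_{x′+e_ν} − δ_{x′})`.** [cite: Balaban1983Higgs3, (2.5) p.424] -/
theorem colDiff_eq_kf (A m2 : ℝ) (hs : Fits M M0 s) (x x' xe' : ↥(boxDom (fun i => n * M i))) :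
    (n : ℝ) * (dK n A m2 hs x xe' - dK n A m2 hs x x') = kf n A m2 hs (indDiff n x' xe') x := by
  rw [indDiff, kf_smul, kf_sub, ← dK_eq_kf, ← dK_eq_kf]

/-- a matrix applied to the column-difference source is `n·`(difference of two of its columns). [folklore] -/
private theorem mulVec_indDiff (T : Matrix ↥(boxDom (fun i => n * M i)) ↥(boxDom (fun i => n * M i)) ℝ)
    (x' xe' z : ↥(boxDom (fun i => n * M i))) : (T *ᵥ indDiff n x' xe') z = (n : ℝ) * (T z xe' - T z x') := by
  rw [indDiff, Matrix.mulVec_smul, Matrix.mulVec_sub]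
  simp only [Pi.smul_apply, Pi.sub_apply, smul_eq_mul, mulVec_ind]

/-- **THE REPRESENTATION OF `δG_k(Ω,Ω₂,0)` THROUGH THE COMMUTATOR** (the cutoff–commutator identity
`B4Delta112ZeroBox.deltaG_decomp` specialised to sources living where the cutoff is `1`): for `f` with `f(z) ≠ 0 ⇒ χ(z) = 1` and
`x` with `χ(x) = 1`, `(G₀Ef)(x+ns) − (Gf)(x) = −Σ_y G₀(x+ns, y)·(E[H(□),χ]Gf)(y)`.  Here `χ = B4Delta112ZeroBox.chi` is the product
cutoff (vanishing on the boundary layer of `□` inside `□₀`, `= 1` one unit cube inside), `[H(□),χ] = B4Delta112ZeroBox.comm`.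
[cite: Balaban1983Higgs3, (2.5) p.424] -/
theorem kf_eq (hn : 2 ≤ n) {A m2 : ℝ} (hA : 0 < A) (hm : 0 ≤ m2) (hs : Fits M M0 s) (hM : ∀ i, 1 ≤ M i)
    (f : ↥(boxDom (fun i => n * M i)) → ℝ) (hf : ∀ z, f z ≠ 0 → chi n M M0 s z.1 = 1)
    (x : ↥(boxDom (fun i => n * M i))) (hx : chi n M M0 s x.1 = 1) :
    kf n A m2 hs f x = -∑ y, (boxOpR n A m2 M0)⁻¹ (emb (hs.scale n) x) y *
        B4Delta112ZeroBox.ext n M M0 s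
          (B4Delta112ZeroBox.comm n A m2 M (fun z => chi n M M0 s z.1) ((boxOpR n A m2 M)⁻¹ *ᵥ f)) y := by
  have hn1 : 1 ≤ n := by omega
  have hχ : ∀ z, (extNbrs n hs z).Nonempty → (fun z' => chi n M M0 s z'.1) z = 0 :=
    fun z hz => chi_eq_zero_of_extNbrs hn1 hs z hz
  have hdec := deltaG_decomp hn1 hA hm hs hM (fun z' => chi n M M0 s z'.1) hχ f x
  have h0 : (fun z => (1 - (fun z' => chi n M M0 s z'.1) z) * f z) = fun _ => 0 := by
    funext z
    by_cases hz : f z = 0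
    · simp [hz]
    · simp [hf z hz]
  have hext0 : B4Delta112ZeroBox.ext n M M0 s (fun _ : ↥(boxDom (fun i => n * M i)) => (0 : ℝ)) = fun _ => 0 := by
    funext y
    simp only [B4Delta112ZeroBox.ext]
    split_ifs <;> rfl
  rw [h0, hext0] at hdec
  have hz : ((boxOpR n A m2 M0)⁻¹ *ᵥ fun _ : ↥(boxDom (fun i => n * M0 i)) => (0 : ℝ)) = 0 := by
    ext y; simp [Matrix.mulVec, dotProduct]
  rw [hz] at hdec
  simp only [hx, sub_self, zero_mul, Pi.zero_apply, zero_add] at hdec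
  unfold kf
  rw [show ((boxOpR n A m2 M0)⁻¹ *ᵥ B4Delta112ZeroBox.ext n M M0 s f) (emb (hs.scale n) x)
      - ((boxOpR n A m2 M)⁻¹ *ᵥ f) x
      = -(((boxOpR n A m2 M)⁻¹ *ᵥ f) x
        - ((boxOpR n A m2 M0)⁻¹ *ᵥ B4Delta112ZeroBox.ext n M M0 s f) (emb (hs.scale n) x)) from by ring, hdec]
  rfl

end Kernel

/-! ## §4 The commutator `[H(□), χ]u`: a first-order operator living on the collar -/

section Commutator

variable {n : ℕ} {M M0 : Fin (d + 1) → ℕ} {s : Fin (d + 1) → ℤ}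

/-- **POINTWISE BOUND OF THE COMMUTATOR** from bounds on `u` over the block of `z` and on `n∇u` over the bonds at `z`:
`|[H(□),χ]u(z)| ≤ 16(d+1)·B_∂ + (64(d+1) + A)·B_val` — the three terms of `B4Delta112ZeroBox.comm_eq'` against the cutoff bounds
(C1) `|n∇χ| ≤ 8`, (C2) `|n²Δχ| ≤ 64(d+1)`, and `|χ(z′) − χ(z)| ≤ 1` on the `n^{d+1}` points of the block (the pattern of
`B4Delta112ZeroBox.comm_pt`, with the pointwise inputs abstracted). [cite: Balaban1983Higgs3, (2.5) p.424] -/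
theorem abs_comm_le (hn : 2 ≤ n) (hM : ∀ i, 1 ≤ M i) {A m2 Bv Bd' : ℝ} (hA : 0 ≤ A) (hBv : 0 ≤ Bv) (hBd : 0 ≤ Bd')
    (u : ↥(boxDom (fun i => n * M i)) → ℝ) (z : ↥(boxDom (fun i => n * M i)))
    (hval : ∀ z' ∈ boxBlk n (fun i => n * M i) z, |u z'| ≤ Bv)
    (hder : ∀ z' ∈ boxNbrs (fun i => n * M i) z, |(n : ℝ) * (u z' - u z)| ≤ Bd') :
    |B4Delta112ZeroBox.comm n A m2 M (fun z' => chi n M M0 s z'.1) u z|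
      ≤ 16 * ((d : ℝ) + 1) * Bd' + (64 * ((d : ℝ) + 1) + A) * Bv := by
  have hn1 : 1 ≤ n := by omega
  rw [comm_eq']
  have hT1 : |∑ z' ∈ boxNbrs (fun i => n * M i) z,
      (n : ℝ) * (chi n M M0 s z.1 - chi n M M0 s z'.1) * ((n : ℝ) * (u z' - u z))| ≤ 2 * ((d : ℝ) + 1) * (8 * Bd') := by
    calc |∑ z' ∈ boxNbrs (fun i => n * M i) z,
          (n : ℝ) * (chi n M M0 s z.1 - chi n M M0 s z'.1) * ((n : ℝ) * (u z' - u z))|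
        ≤ ∑ z' ∈ boxNbrs (fun i => n * M i) z,
          |(n : ℝ) * (chi n M M0 s z.1 - chi n M M0 s z'.1) * ((n : ℝ) * (u z' - u z))| :=
          Finset.abs_sum_le_sum_abs _ _
      _ ≤ ∑ _z' ∈ boxNbrs (fun i => n * M i) z, 8 * Bd' := by
          refine Finset.sum_le_sum fun z' hz' => ?_
          have hzn : z'.1 ∈ nbrs z.1 := by
            unfold boxNbrs at hz'; rw [Finset.mem_filter] at hz'; exact hz'.2
          rw [abs_mul]
          exact mul_le_mul (abs_chi_sub_nbr_le n M M0 s z.2 z'.2 hzn) (hder z' hz') (abs_nonneg _) (by norm_num)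
      _ = (boxNbrs (fun i => n * M i) z).card * (8 * Bd') := by rw [Finset.sum_const, nsmul_eq_mul]
      _ ≤ 2 * ((d : ℝ) + 1) * (8 * Bd') := by
          refine mul_le_mul_of_nonneg_right ?_ (by positivity)
          exact_mod_cast card_boxNbrs_le z
  have hT2 : |u z * ((n : ℝ) ^ 2 * ∑ z' ∈ boxNbrs (fun i => n * M i) z, (chi n M M0 s z.1 - chi n M M0 s z'.1))|
      ≤ Bv * (64 * ((d : ℝ) + 1)) := by
    rw [abs_mul]
    exact mul_le_mul (hval z (mem_boxBlk_self n z)) (abs_lap_chi_le M M0 s hn hM z) (abs_nonneg _) hBv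
  have hT3 : |A * ((n : ℝ) ^ (d + 1))⁻¹ *
      ∑ z' ∈ boxBlk n (fun i => n * M i) z, (chi n M M0 s z'.1 - chi n M M0 s z.1) * u z'| ≤ A * Bv := by
    have hn0 : (0 : ℝ) < (n : ℝ) ^ (d + 1) := by positivity
    rw [abs_mul, abs_of_nonneg (by positivity : (0 : ℝ) ≤ A * ((n : ℝ) ^ (d + 1))⁻¹)]
    calc A * ((n : ℝ) ^ (d + 1))⁻¹ *
          |∑ z' ∈ boxBlk n (fun i => n * M i) z, (chi n M M0 s z'.1 - chi n M M0 s z.1) * u z'|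
        ≤ A * ((n : ℝ) ^ (d + 1))⁻¹ * ∑ z' ∈ boxBlk n (fun i => n * M i) z, 1 * Bv := by
          refine mul_le_mul_of_nonneg_left ((Finset.abs_sum_le_sum_abs _ _).trans
            (Finset.sum_le_sum fun z' hz' => ?_)) (by positivity)
          rw [abs_mul]
          refine mul_le_mul ?_ (hval z' hz') (abs_nonneg _) zero_le_one
          rw [abs_sub_le_iff]
          constructor <;> linarith [chi_nonneg n M M0 s z'.1, chi_le_one n M M0 s z'.1,
            chi_nonneg n M M0 s z.1, chi_le_one n M M0 s z.1]
      _ = A * Bv := by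
          rw [Finset.sum_const, card_boxBlk_eq hn1 z, nsmul_eq_mul, one_mul]
          push_cast
          field_simp
  refine (abs_add_three _ _ _).trans ?_
  refine (add_le_add (add_le_add hT1 hT2) hT3).trans (le_of_eq ?_)
  ring

/-- **OFF THE COLLAR THE COMMUTATOR VANISHES**: there `χ ≡ 1` at the point, at its neighbours and on its block (the second branch
of `B4Delta112ZeroBox.comm_pt`). [cite: Balaban1983Higgs3, (2.5) p.424] -/
theorem comm_eq_zero_of_not_bd (hn : 2 ≤ n) (hs : Fits M M0 s) (hM : ∀ i, 1 ≤ M i) (A m2 : ℝ)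
    (u : ↥(boxDom (fun i => n * M i)) → ℝ) {z : ↥(boxDom (fun i => n * M i))} (hbd : ¬ Bd n hs z) :
    B4Delta112ZeroBox.comm n A m2 M (fun z' => chi n M M0 s z'.1) u z = 0 := by
  have hn1 : 1 ≤ n := by omega
  have h1 : ∀ z' : ↥(boxDom (fun i => n * M i)), supNorm (z.1 - z'.1) ≤ n → chi n M M0 s z'.1 = 1 :=
    fun z' hzz' => chi_eq_one_of_not_bd hn hs hM hzz' hbd
  have hz1 : chi n M M0 s z.1 = 1 := h1 z (by rw [sub_self, supNorm_zero']; exact Nat.cast_nonneg n)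
  rw [comm_eq]
  rw [Finset.sum_eq_zero, Finset.sum_eq_zero]
  · ring
  · intro z' hz'
    rw [h1 z' (supNorm_sub_le_of_boxBlk hn1 hz'), hz1, sub_self, zero_mul]
  · intro z' hz'
    have hzn : z'.1 ∈ nbrs z.1 := by
      unfold boxNbrs at hz'; rw [Finset.mem_filter] at hz'; exact hz'.2
    rw [h1 z' ((supNorm_sub_le_one_of_mem_nbrs hzn).trans (by exact_mod_cast hn1)), hz1, sub_self, zero_mul]

end Commutator

/-! ## §5 The column side, pointwise: the commutator applied to a column of the inner Green's function (or to a column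
difference) is `O(n^{−(d+1)})·e^{−(δ/2)r}·e^{−(δ/2)|z−x′|_∞/n}` everywhere -/

section ColumnSide

variable {n : ℕ} {M M0 : Fin (d + 1) → ℕ} {s : Fin (d + 1) → ℤ}

/-- kernel: `e^{−δ·D′/n} ≤ e^{δ}·e^{−δ·D/n}` when `D ≤ D′ + n`. [folklore] -/
private theorem exp_shift_le {δ D D' : ℝ} (hn : 1 ≤ n) (hδ : 0 ≤ δ) (h : D ≤ D' + n) :
    Real.exp (-(δ * (D' / n))) ≤ Real.exp δ * Real.exp (-(δ * (D / n))) := by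
  rw [← Real.exp_add]
  apply Real.exp_le_exp.2
  have hn0 : (0 : ℝ) < n := by exact_mod_cast (show 0 < n by omega)
  have h1 : D / n ≤ D' / n + 1 := by
    rw [div_le_iff₀ hn0, add_mul, div_mul_cancel₀ _ hn0.ne', one_mul]
    exact h
  nlinarith

/-- kernel: on the collar the full rate splits into the margin factor and half the rate:
`e^{δ}·e^{−δD/n} ≤ e^{2δ}·e^{−(δ/2)r}·e^{−(δ/2)D/n}` when `n(r − 2) ≤ D`. [folklore] -/
private theorem exp_split_le {δ D : ℝ} {r : ℕ} (hn : 1 ≤ n) (hδ : 0 ≤ δ) (h : (n : ℝ) * ((r : ℝ) - 2) ≤ D) :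
    Real.exp δ * Real.exp (-(δ * (D / n)))
      ≤ Real.exp (2 * δ) * Real.exp (-(δ / 2 * r)) * Real.exp (-(δ / 2 * (D / n))) := by
  rw [← Real.exp_add, ← Real.exp_add, ← Real.exp_add]
  apply Real.exp_le_exp.2
  have hn0 : (0 : ℝ) < n := by exact_mod_cast (show 0 < n by omega)
  have h1 : (r : ℝ) - 2 ≤ D / n := by rw [le_div_iff₀ hn0]; linarith
  nlinarith

/-- **THE COMMUTATOR AGAINST A DECAYING COLUMN.**  Let `u` be a function on the inner box whose values and bond differences obey,
at every base point `w` with `|w − x′|_∞ ≥ n/2`, `n^{d+1}|u(w)| ≤ C_u e^{−δ|w−x′|/n}` and `n^{d+1}|n(u(w+e_μ) − u(w))| ≤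
C_∂ e^{−δ|w−x′|/n}`, for a point `x′` of margin `r ≥ 3`.  Then for EVERY `z`:
`|[H(□),χ]u(z)| ≤ n^{−(d+1)}·(16(d+1)C_∂ + (64(d+1) + A₊)C_u)·e^{2δ}·e^{−(δ/2)r}·e^{−(δ/2)|z−x′|_∞/n}` (on the collar by `abs_comm_le`
and `sep_of_margin_bd`; off the collar the commutator vanishes). [cite: Balaban1983Higgs3, (2.5) p.424] -/
theorem abs_comm_decay_le (hn : 2 ≤ n) (hs : Fits M M0 s) (hM : ∀ i, 1 ≤ M i) {A Ab m2 δ Cu Cdu : ℝ} (hA : 0 ≤ A)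
    (hAb : A ≤ Ab) (hδ : 0 ≤ δ) (hCu : 0 ≤ Cu) (hCdu : 0 ≤ Cdu) (u : ↥(boxDom (fun i => n * M i)) → ℝ)
    (x' : ↥(boxDom (fun i => n * M i)))
    (hu : ∀ w : ↥(boxDom (fun i => n * M i)), (1 / 2 : ℝ) * n ≤ supNorm (w.1 - x'.1) →
      (n : ℝ) ^ (d + 1) * |u w| ≤ Cu * Real.exp (-(δ * (supNorm (w.1 - x'.1) / n))))
    (hdu : ∀ (μ : Fin (d + 1)) (w we : ↥(boxDom (fun i => n * M i))), we.1 = w.1 + Pi.single μ 1 →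
      (1 / 2 : ℝ) * n ≤ supNorm (w.1 - x'.1) →
      (n : ℝ) ^ (d + 1) * |(n : ℝ) * (u we - u w)| ≤ Cdu * Real.exp (-(δ * (supNorm (w.1 - x'.1) / n))))
    {r : ℕ} (hr : 3 ≤ r) (hx' : Margin n hs r x') (z : ↥(boxDom (fun i => n * M i))) :
    |B4Delta112ZeroBox.comm n A m2 M (fun z' => chi n M M0 s z'.1) u z|
      ≤ ((n : ℝ) ^ (d + 1))⁻¹ * ((16 * ((d : ℝ) + 1) * Cdu + (64 * ((d : ℝ) + 1) + Ab) * Cu) * Real.exp (2 * δ)) *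
        Real.exp (-(δ / 2 * r)) * Real.exp (-(δ / 2 * (supNorm (z.1 - x'.1) / n))) := by
  have hn1 : 1 ≤ n := by omega
  have hnR : (0 : ℝ) < n := by exact_mod_cast (show 0 < n by omega)
  have hnp : (0 : ℝ) < (n : ℝ) ^ (d + 1) := by positivity
  have hn2 : (2 : ℝ) ≤ n := by exact_mod_cast hn
  have hr3 : (3 : ℝ) ≤ r := by exact_mod_cast hr
  have hK : 0 ≤ 16 * ((d : ℝ) + 1) * Cdu + (64 * ((d : ℝ) + 1) + Ab) * Cu :=
    add_nonneg (by positivity) (mul_nonneg (add_nonneg (by positivity) (hA.trans hAb)) hCu)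
  by_cases hbd : Bd n hs z
  · -- on the collar
    set E : ℝ := Real.exp (-(δ * (supNorm (z.1 - x'.1) / n))) with hE
    have hE0 : 0 < E := Real.exp_pos _
    -- separation of the block of `z` and of its neighbours from `x′`
    have hsepB : ∀ w : ↥(boxDom (fun i => n * M i)), blk n w.1 = blk n z.1 →
        (1 / 2 : ℝ) * n ≤ supNorm (w.1 - x'.1) := by
      intro w hw
      have h := sep_of_margin_bd hn1 hs hx' hbd hw
      nlinarith
    have hsepN : ∀ w : ↥(boxDom (fun i => n * M i)), w.1 ∈ nbrs z.1 →
        (1 / 2 : ℝ) * n ≤ supNorm (w.1 - x'.1) := by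
      intro w hw
      have h := sep_of_margin_bd_nbr hn1 hs hx' hbd hw
      nlinarith
    have hsep0 : (1 / 2 : ℝ) * n ≤ supNorm (z.1 - x'.1) := hsepB z rfl
    -- the exponential at nearby points
    have hexpB : ∀ w : ↥(boxDom (fun i => n * M i)), w ∈ boxBlk n (fun i => n * M i) z →
        Real.exp (-(δ * (supNorm (w.1 - x'.1) / n))) ≤ Real.exp δ * E := by
      intro w hw
      have h1 := supNorm_sub_le_of_boxBlk hn1 hw
      have t := supNorm_sub_le_sub_add_sub z.1 w.1 x'.1
      exact exp_shift_le hn1 hδ (by linarith)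
    have hexpN : ∀ w : ↥(boxDom (fun i => n * M i)), w.1 ∈ nbrs z.1 →
        Real.exp (-(δ * (supNorm (w.1 - x'.1) / n))) ≤ Real.exp δ * E := by
      intro w hw
      have h1 := supNorm_sub_le_one_of_mem_nbrs hw
      have t := supNorm_sub_le_sub_add_sub z.1 w.1 x'.1
      have hn1' : (1 : ℝ) ≤ n := by exact_mod_cast hn1
      exact exp_shift_le hn1 hδ (by linarith)
    -- the two pointwise inputs of `abs_comm_le`
    have hval : ∀ w ∈ boxBlk n (fun i => n * M i) z, |u w| ≤ ((n : ℝ) ^ (d + 1))⁻¹ * (Cu * (Real.exp δ * E)) := by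
      intro w hw
      have hwb : blk n w.1 = blk n z.1 := by
        unfold boxBlk at hw; rw [Finset.mem_filter] at hw; exact hw.2
      have h := hu w (hsepB w hwb)
      rw [le_inv_mul_iff₀ hnp]
      exact h.trans (mul_le_mul_of_nonneg_left (hexpB w hw) hCu)
    have hder : ∀ w ∈ boxNbrs (fun i => n * M i) z,
        |(n : ℝ) * (u w - u z)| ≤ ((n : ℝ) ^ (d + 1))⁻¹ * (Cdu * (Real.exp δ * E)) := by
      intro w hw
      have hwn : w.1 ∈ nbrs z.1 := by
        unfold boxNbrs at hw; rw [Finset.mem_filter] at hw; exact hw.2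
      rw [le_inv_mul_iff₀ hnp]
      obtain ⟨μ, hμ | hμ⟩ := mem_nbrs.1 hwn
      · -- forward bond at `z`
        have h := hdu μ z w hμ hsep0
        have hE1 : E ≤ Real.exp δ * E := by
          have : 1 ≤ Real.exp δ := Real.one_le_exp hδ
          nlinarith
        exact h.trans (mul_le_mul_of_nonneg_left hE1 hCdu)
      · -- backward bond: base point `w`, `z = w + e_μ`
        have hzw : z.1 = w.1 + Pi.single μ 1 := by rw [hμ]; simp
        have h := hdu μ w z hzw (hsepN w hwn)
        rw [show (n : ℝ) * (u w - u z) = -((n : ℝ) * (u z - u w)) by ring, abs_neg]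
        exact h.trans (mul_le_mul_of_nonneg_left (hexpN w hwn) hCdu)
    have hB1 : 0 ≤ ((n : ℝ) ^ (d + 1))⁻¹ * (Cu * (Real.exp δ * E)) := by positivity
    have hB2 : 0 ≤ ((n : ℝ) ^ (d + 1))⁻¹ * (Cdu * (Real.exp δ * E)) := by positivity
    have hc := abs_comm_le (M0 := M0) (s := s) (m2 := m2) hn hM hA hB1 hB2 u z hval hder
    have hsplit := exp_split_le (δ := δ) (r := r) hn1 hδ (sep_of_margin_bd hn1 hs hx' hbd (w := z) rfl)
    rw [← hE] at hsplit
    calc |B4Delta112ZeroBox.comm n A m2 M (fun z' => chi n M M0 s z'.1) u z|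
        ≤ 16 * ((d : ℝ) + 1) * (((n : ℝ) ^ (d + 1))⁻¹ * (Cdu * (Real.exp δ * E)))
          + (64 * ((d : ℝ) + 1) + A) * (((n : ℝ) ^ (d + 1))⁻¹ * (Cu * (Real.exp δ * E))) := hc
      _ ≤ 16 * ((d : ℝ) + 1) * (((n : ℝ) ^ (d + 1))⁻¹ * (Cdu * (Real.exp δ * E)))
          + (64 * ((d : ℝ) + 1) + Ab) * (((n : ℝ) ^ (d + 1))⁻¹ * (Cu * (Real.exp δ * E))) := by
          have := mul_le_mul_of_nonneg_right hAb hB1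
          linarith
      _ = ((n : ℝ) ^ (d + 1))⁻¹ * (16 * ((d : ℝ) + 1) * Cdu + (64 * ((d : ℝ) + 1) + Ab) * Cu) * (Real.exp δ * E) := by
          ring
      _ ≤ ((n : ℝ) ^ (d + 1))⁻¹ * (16 * ((d : ℝ) + 1) * Cdu + (64 * ((d : ℝ) + 1) + Ab) * Cu)
          * (Real.exp (2 * δ) * Real.exp (-(δ / 2 * r)) * Real.exp (-(δ / 2 * (supNorm (z.1 - x'.1) / n)))) :=
          mul_le_mul_of_nonneg_left hsplit (mul_nonneg (inv_nonneg.2 hnp.le) hK)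
      _ = _ := by ring
  · -- off the collar
    rw [comm_eq_zero_of_not_bd hn hs hM A m2 u hbd, abs_zero]
    have : 0 ≤ ((n : ℝ) ^ (d + 1))⁻¹ := inv_nonneg.2 hnp.le
    positivity

/-- **THE COMMUTATOR AGAINST THE COLUMN `G(·,x′)` OF THE INNER GREEN'S FUNCTION**, `x′` of margin `r ≥ 3`, from the value and
row-derivative kernel clauses of `G_k(□,0)` at separation `n/2` ((2.10) summed over the scales, `B3GkZeroBoxSeparated`): for every `z`,
`|[H(□),χ]G(·,x′)(z)| ≤ n^{−(d+1)}(16(d+1)C_D + (64(d+1) + A₊)C_V)e^{2δ}e^{−(δ/2)r}e^{−(δ/2)|z−x′|_∞/n}`. [cite: Balaban1983Higgs3, (2.10) p.426] -/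
theorem abs_comm_col_le (hn : 2 ≤ n) (hs : Fits M M0 s) (hM : ∀ i, 1 ≤ M i) {A Ab m2 δ CV CD : ℝ} (hA : 0 ≤ A)
    (hAb : A ≤ Ab) (hδ : 0 ≤ δ) (hCV : 0 ≤ CV) (hCD : 0 ≤ CD)
    (G : Matrix ↥(boxDom (fun i => n * M i)) ↥(boxDom (fun i => n * M i)) ℝ)
    (hV : ∀ w x' : ↥(boxDom (fun i => n * M i)), (1 / 2 : ℝ) * n ≤ supNorm (w.1 - x'.1) →
      (n : ℝ) ^ (d + 1) * |G w x'| ≤ CV * Real.exp (-(δ * (supNorm (w.1 - x'.1) / n))))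
    (hD : ∀ (μ : Fin (d + 1)) (w we : ↥(boxDom (fun i => n * M i))), we.1 = w.1 + Pi.single μ 1 →
      ∀ x' : ↥(boxDom (fun i => n * M i)), (1 / 2 : ℝ) * n ≤ supNorm (w.1 - x'.1) →
      (n : ℝ) ^ (d + 1) * ((n : ℝ) * |G we x' - G w x'|) ≤ CD * Real.exp (-(δ * (supNorm (w.1 - x'.1) / n))))
    {r : ℕ} (hr : 3 ≤ r) (x' : ↥(boxDom (fun i => n * M i))) (hx' : Margin n hs r x')
    (z : ↥(boxDom (fun i => n * M i))) :
    |B4Delta112ZeroBox.comm n A m2 M (fun z' => chi n M M0 s z'.1) (fun w => G w x') z|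
      ≤ ((n : ℝ) ^ (d + 1))⁻¹ * ((16 * ((d : ℝ) + 1) * CD + (64 * ((d : ℝ) + 1) + Ab) * CV) * Real.exp (2 * δ)) *
        Real.exp (-(δ / 2 * r)) * Real.exp (-(δ / 2 * (supNorm (z.1 - x'.1) / n))) := by
  refine abs_comm_decay_le hn hs hM hA hAb hδ hCV hCD (fun w => G w x') x' (fun w hw => hV w x' hw)
    (fun μ w we hwe hw => ?_) hr hx' z
  have h := hD μ w we hwe x' hw
  have hnR : (0 : ℝ) ≤ n := Nat.cast_nonneg n
  rwa [abs_mul, abs_of_nonneg hnR] 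

/-- **THE COMMUTATOR AGAINST A COLUMN DIFFERENCE `n(G(·,x′+e_ν) − G(·,x′))`**, `x′` of margin `r ≥ 3`, from the column-derivative
and mixed kernel clauses of `G_k(□,0)` at separation `n/2` ((2.10) «for each differentiation an additional factor (L^jη)^{−1}»):
for every `z`, `|[H(□),χ]u(z)| ≤ n^{−(d+1)}(16(d+1)C_M + (64(d+1) + A₊)C_D′)e^{2δ}e^{−(δ/2)r}e^{−(δ/2)|z−x′|_∞/n}`.
[cite: Balaban1983Higgs3, (2.10) p.426] -/
theorem abs_comm_colDiff_le (hn : 2 ≤ n) (hs : Fits M M0 s) (hM : ∀ i, 1 ≤ M i) {A Ab m2 δ CD' CM : ℝ} (hA : 0 ≤ A)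
    (hAb : A ≤ Ab) (hδ : 0 ≤ δ) (hCD' : 0 ≤ CD') (hCM : 0 ≤ CM)
    (G : Matrix ↥(boxDom (fun i => n * M i)) ↥(boxDom (fun i => n * M i)) ℝ)
    (hD' : ∀ (w : ↥(boxDom (fun i => n * M i))) (ν : Fin (d + 1)) (x' xe' : ↥(boxDom (fun i => n * M i))),
      xe'.1 = x'.1 + Pi.single ν 1 → (1 / 2 : ℝ) * n ≤ supNorm (w.1 - x'.1) →
      (n : ℝ) ^ (d + 1) * ((n : ℝ) * |G w xe' - G w x'|) ≤ CD' * Real.exp (-(δ * (supNorm (w.1 - x'.1) / n))))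
    (hMx : ∀ (μ ν : Fin (d + 1)) (w we : ↥(boxDom (fun i => n * M i))), we.1 = w.1 + Pi.single μ 1 →
      ∀ (x' xe' : ↥(boxDom (fun i => n * M i))), xe'.1 = x'.1 + Pi.single ν 1 →
      (1 / 2 : ℝ) * n ≤ supNorm (w.1 - x'.1) →
      (n : ℝ) ^ (d + 1) * ((n : ℝ) ^ 2 * |(G we xe' - G w xe') - (G we x' - G w x')|)
        ≤ CM * Real.exp (-(δ * (supNorm (w.1 - x'.1) / n))))
    {r : ℕ} (hr : 3 ≤ r) {ν : Fin (d + 1)} (x' xe' : ↥(boxDom (fun i => n * M i)))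
    (hxe' : xe'.1 = x'.1 + Pi.single ν 1) (hx' : Margin n hs r x') (z : ↥(boxDom (fun i => n * M i))) :
    |B4Delta112ZeroBox.comm n A m2 M (fun z' => chi n M M0 s z'.1) (fun w => (n : ℝ) * (G w xe' - G w x')) z|
      ≤ ((n : ℝ) ^ (d + 1))⁻¹ * ((16 * ((d : ℝ) + 1) * CM + (64 * ((d : ℝ) + 1) + Ab) * CD') * Real.exp (2 * δ)) *
        Real.exp (-(δ / 2 * r)) * Real.exp (-(δ / 2 * (supNorm (z.1 - x'.1) / n))) := by
  have hnR : (0 : ℝ) ≤ n := Nat.cast_nonneg n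
  refine abs_comm_decay_le hn hs hM hA hAb hδ hCD' hCM (fun w => (n : ℝ) * (G w xe' - G w x')) x'
    (fun w hw => ?_) (fun μ w we hwe hw => ?_) hr hx' z
  · have h := hD' w ν x' xe' hxe' hw
    rwa [abs_mul, abs_of_nonneg hnR]
  · have h := hMx μ ν w we hwe x' xe' hxe' hw
    rw [show (n : ℝ) * ((n : ℝ) * (G we xe' - G we x') - (n : ℝ) * (G w xe' - G w x'))
        = (n : ℝ) ^ 2 * ((G we xe' - G w xe') - (G we x' - G w x')) by ring, abs_mul, abs_of_nonneg (by positivity)]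
    exact h

end ColumnSide

/-! ## §6 The row side: weighted `ℓ¹` row bounds of the outer Green's function paired against §5 — the four core clauses -/

section Core

variable {n : ℕ} {M M0 : Fin (d + 1) → ℕ} {s : Fin (d + 1) → ℤ}

/-- kernel: **WEIGHTED PAIRING** — a weighted `ℓ¹` bound against a pointwise weighted bound (general weight). [folklore] -/
private theorem abs_sum_mul_le_of_wt {ι : Type*} [Fintype ι] {c Φ : ℝ} (g h W : ι → ℝ)
    (hg : ∑ y, |g y| * W y ≤ c) (hΦ : 0 ≤ Φ) (hh : ∀ y, |h y| ≤ W y * Φ) : |∑ y, g y * h y| ≤ c * Φ :=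
  calc |∑ y, g y * h y| ≤ ∑ y, |g y| * |h y| :=
        (Finset.abs_sum_le_sum_abs _ _).trans (le_of_eq (Finset.sum_congr rfl fun y _ => abs_mul _ _))
    _ ≤ ∑ y, |g y| * (W y * Φ) := Finset.sum_le_sum fun y _ => mul_le_mul_of_nonneg_left (hh y) (abs_nonneg _)
    _ = (∑ y, |g y| * W y) * Φ := by rw [Finset.sum_mul]; exact Finset.sum_congr rfl fun y _ => by ring
    _ ≤ c * Φ := mul_le_mul_of_nonneg_right hg hΦ

/-- kernel: transporting a pointwise weighted bound through the extension by zero. [folklore] -/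
private theorem abs_ext_le_wt (hs : Fits M M0 s) {Φ : ℝ} (hΦ : 0 ≤ Φ) (w : ↥(boxDom (fun i => n * M i)) → ℝ)
    (W : ↥(boxDom (fun i => n * M0 i)) → ℝ) (hW : ∀ y, 0 ≤ W y)
    (hw : ∀ z, |w z| ≤ W (emb (hs.scale n) z) * Φ) (y : ↥(boxDom (fun i => n * M0 i))) :
    |B4Delta112ZeroBox.ext n M M0 s w y| ≤ W y * Φ := by
  by_cases hy : (y.1 - fun i => (n : ℤ) * s i) ∈ boxDom (fun i => n * M i)
  · have hyz : y = emb (hs.scale n) ⟨_, hy⟩ := (emb_of_mem hs hy).symm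
    rw [hyz, ext_emb hs]
    exact hw _
  · rw [ext_of_not_mem w hy, abs_zero]
    exact mul_nonneg (hW y) hΦ

/-- kernel: the exponent bookkeeping of the value/derivative clauses — `e^{−(δ/2)|z−x′|/n} ≤ e^{δ|x−z|/n}·e^{−(δ/2)|x−x′|/n}`.
[folklore] -/
private theorem exp_col_le_wt {δ : ℝ} (hδ : 0 ≤ δ) (hn : 1 ≤ n) (x z x' : Fin (d + 1) → ℤ) :
    Real.exp (-(δ / 2 * (supNorm (z - x') / n)))
      ≤ Real.exp (δ * supNorm (x - z) / n) * Real.exp (-(δ / 2 * (supNorm (x - x') / n))) := by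
  rw [← Real.exp_add]
  apply Real.exp_le_exp.2
  have hn0 : (0 : ℝ) < n := by exact_mod_cast (show 0 < n by omega)
  have t := supNorm_sub_le_sub_add_sub x z x'
  have h0 := supNorm_nonneg (x - z)
  have h1 : supNorm (x - x') / n ≤ supNorm (x - z) / n + supNorm (z - x') / n := by
    rw [← add_div]; exact div_le_div_of_nonneg_right t hn0.le
  have h2 : 0 ≤ supNorm (x - z) / n := div_nonneg h0 hn0.le
  have h3 : δ * (supNorm (x - x') / n) ≤ δ * (supNorm (x - z) / n) + δ * (supNorm (z - x') / n) := by
    have := mul_le_mul_of_nonneg_left h1 hδ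
    rwa [mul_add] at this
  have h4 : 0 ≤ δ * (supNorm (x - z) / n) := mul_nonneg hδ h2
  rw [mul_div_assoc]
  linarith

/-- kernel: the exponent bookkeeping of the Hölder clause —
`e^{−(δ/2)|z−x′|/n} ≤ e^{δ min(|x₁−z|,|x₂−z|)/n}·e^{−(δ/2)min(|x₁−x′|,|x₂−x′|)/n}`. [folklore] -/
private theorem exp_col_le_wt_min {δ : ℝ} (hδ : 0 ≤ δ) (hn : 1 ≤ n) (x₁ x₂ z x' : Fin (d + 1) → ℤ) :
    Real.exp (-(δ / 2 * (supNorm (z - x') / n)))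
      ≤ Real.exp (δ * min (supNorm (x₁ - z)) (supNorm (x₂ - z)) / n) *
        Real.exp (-(δ / 2 * (min (supNorm (x₁ - x')) (supNorm (x₂ - x')) / n))) := by
  rw [← Real.exp_add]
  apply Real.exp_le_exp.2
  have hn0 : (0 : ℝ) < n := by exact_mod_cast (show 0 < n by omega)
  have t1 := supNorm_sub_le_sub_add_sub x₁ z x'
  have t2 := supNorm_sub_le_sub_add_sub x₂ z x'
  have hmin : min (supNorm (x₁ - x')) (supNorm (x₂ - x'))
      ≤ min (supNorm (x₁ - z)) (supNorm (x₂ - z)) + supNorm (z - x') := by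
    have := min_le_min t1 t2
    rwa [min_add_add_right] at this
  have h0 : 0 ≤ min (supNorm (x₁ - z)) (supNorm (x₂ - z)) := le_min (supNorm_nonneg _) (supNorm_nonneg _)
  have h1 : min (supNorm (x₁ - x')) (supNorm (x₂ - x')) / n
      ≤ min (supNorm (x₁ - z)) (supNorm (x₂ - z)) / n + supNorm (z - x') / n := by
    rw [← add_div]; exact div_le_div_of_nonneg_right hmin hn0.le
  have h2 : 0 ≤ min (supNorm (x₁ - z)) (supNorm (x₂ - z)) / n := div_nonneg h0 hn0.le
  have h3 : δ * (min (supNorm (x₁ - x')) (supNorm (x₂ - x')) / n)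
      ≤ δ * (min (supNorm (x₁ - z)) (supNorm (x₂ - z)) / n) + δ * (supNorm (z - x') / n) := by
    have := mul_le_mul_of_nonneg_left h1 hδ
    rwa [mul_add] at this
  have h4 : 0 ≤ δ * (min (supNorm (x₁ - z)) (supNorm (x₂ - z)) / n) := mul_nonneg hδ h2
  rw [mul_div_assoc]
  linarith

/-- the constant of the core clauses: `c₀·(16(d+1)C_∂ + (64(d+1) + A₊)C_u)·e^{2δ}`. [folklore] -/
def cCore25 (d : ℕ) (c₀ Ab δ Cu Cdu : ℝ) : ℝ :=
  c₀ * ((16 * ((d : ℝ) + 1) * Cdu + (64 * ((d : ℝ) + 1) + Ab) * Cu) * Real.exp (2 * δ))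

/-- the core constant is nonnegative. [folklore] -/
private theorem cCore25_nonneg (d : ℕ) {c₀ Ab δ Cu Cdu : ℝ} (hc₀ : 0 ≤ c₀) (hAb : 0 ≤ Ab) (hCu : 0 ≤ Cu) (hCdu : 0 ≤ Cdu) :
    0 ≤ cCore25 d c₀ Ab δ Cu Cdu := by
  unfold cCore25
  have : 0 ≤ (64 * ((d : ℝ) + 1) + Ab) * Cu := by positivity
  positivity

/-- the indicator source of a point of margin `r ≥ 2` lives where the cutoff is `1`. [folklore] -/
private theorem ind_support (hn : 2 ≤ n) (hs : Fits M M0 s) (hM : ∀ i, 1 ≤ M i) {r : ℕ} (hr : 2 ≤ r)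
    {x' : ↥(boxDom (fun i => n * M i))} (hx' : Margin n hs r x') :
    ∀ z, ind x' z ≠ 0 → chi n M M0 s z.1 = 1 := by
  intro z hz
  have hzx : z = x' := by
    by_contra h
    exact hz (by simp [ind, h])
  rw [hzx]
  exact chi_eq_one_of_margin hn hs hM hr hx'

/-- the column-difference source of a bond at a point of margin `r ≥ 3` lives where the cutoff is `1`. [folklore] -/
private theorem indDiff_support (hn : 2 ≤ n) (hs : Fits M M0 s) (hM : ∀ i, 1 ≤ M i) {r : ℕ} (hr : 3 ≤ r)
    {ν : Fin (d + 1)} {x' xe' : ↥(boxDom (fun i => n * M i))} (hxe' : xe'.1 = x'.1 + Pi.single ν 1)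
    (hx' : Margin n hs r x') : ∀ z, indDiff n x' xe' z ≠ 0 → chi n M M0 s z.1 = 1 := by
  intro z hz
  by_cases h1 : z = x'
  · rw [h1]; exact chi_eq_one_of_margin hn hs hM (by omega) hx'
  · by_cases h2 : z = xe'
    · rw [h2]
      refine chi_eq_one_of_margin_nbr hn hs hM hr hx' ?_
      exact supNorm_sub_le_one_of_mem_nbrs (mem_nbrs.2 ⟨ν, Or.inl hxe'⟩)
    · exfalso
      apply hz
      simp [indDiff, ind, h1, h2]

/-- **CORE, VALUE CLAUSE**: for points `x, x′` of margin `r ≥ 3`,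
`n^{d+1}|δG(x,x′)| ≤ c_core·e^{−(δ/2)r}·e^{−(δ/2)|x−x′|_∞/n}`, from the weighted row bound of the outer Green's function
(rate `δ`, height `c₀`) and the value/row-derivative kernel clauses of the inner one. [cite: Balaban1983Higgs3, (2.5) p.424] -/
theorem core_value (hn : 2 ≤ n) (hs : Fits M M0 s) (hM : ∀ i, 1 ≤ M i) {A Ab m2 δ c₀ CV CD : ℝ} (hA : 0 < A)
    (hAb : A ≤ Ab) (hm : 0 ≤ m2) (hδ : 0 ≤ δ) (hCV : 0 ≤ CV) (hCD : 0 ≤ CD)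
    (hR0 : ∀ y : ↥(boxDom (fun i => n * M0 i)),
      ∑ y', |(boxOpR n A m2 M0)⁻¹ y y'| * Real.exp (δ * supNorm (y.1 - y'.1) / n) ≤ c₀)
    (hV : ∀ w x' : ↥(boxDom (fun i => n * M i)), (1 / 2 : ℝ) * n ≤ supNorm (w.1 - x'.1) →
      (n : ℝ) ^ (d + 1) * |(boxOpR n A m2 M)⁻¹ w x'| ≤ CV * Real.exp (-(δ * (supNorm (w.1 - x'.1) / n))))
    (hD : ∀ (μ : Fin (d + 1)) (w we : ↥(boxDom (fun i => n * M i))), we.1 = w.1 + Pi.single μ 1 →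
      ∀ x' : ↥(boxDom (fun i => n * M i)), (1 / 2 : ℝ) * n ≤ supNorm (w.1 - x'.1) →
      (n : ℝ) ^ (d + 1) * ((n : ℝ) * |(boxOpR n A m2 M)⁻¹ we x' - (boxOpR n A m2 M)⁻¹ w x'|)
        ≤ CD * Real.exp (-(δ * (supNorm (w.1 - x'.1) / n))))
    {r : ℕ} (hr : 3 ≤ r) (x x' : ↥(boxDom (fun i => n * M i))) (hx : Margin n hs r x) (hx' : Margin n hs r x') :
    (n : ℝ) ^ (d + 1) * |dK n A m2 hs x x'|
      ≤ cCore25 d c₀ Ab δ CV CD * Real.exp (-(δ / 2 * r)) * Real.exp (-(δ / 2 * (supNorm (x.1 - x'.1) / n))) := by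
  have hn1 : 1 ≤ n := by omega
  have hnp : (0 : ℝ) < (n : ℝ) ^ (d + 1) := by positivity
  set G := (boxOpR n A m2 M)⁻¹ with hG
  set K : ℝ := (16 * ((d : ℝ) + 1) * CD + (64 * ((d : ℝ) + 1) + Ab) * CV) * Real.exp (2 * δ) with hK
  have hK0 : 0 ≤ K := by
    rw [hK]
    have : 0 ≤ (64 * ((d : ℝ) + 1) + Ab) * CV := mul_nonneg (add_nonneg (by positivity) (hA.le.trans hAb)) hCV
    positivity
  set Φ : ℝ := ((n : ℝ) ^ (d + 1))⁻¹ * K * Real.exp (-(δ / 2 * r)) *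
    Real.exp (-(δ / 2 * (supNorm (x.1 - x'.1) / n))) with hΦ
  have hΦ0 : 0 ≤ Φ := by rw [hΦ]; positivity
  -- the representation
  have hu : (G *ᵥ ind x') = fun w => G w x' := funext (mulVec_ind G x')
  have hrep := kf_eq hn hA hm hs hM (ind x') (ind_support hn hs hM (by omega) hx') x
    (chi_eq_one_of_margin hn hs hM (by omega) hx)
  rw [← dK_eq_kf, ← hG, hu] at hrep
  -- the pointwise weighted bound of the commutator
  have hw : ∀ z, |B4Delta112ZeroBox.comm n A m2 M (fun z' => chi n M M0 s z'.1) (fun w => G w x') z|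
      ≤ Real.exp (δ * supNorm ((emb (hs.scale n) x).1 - (emb (hs.scale n) z).1) / n) * Φ := by
    intro z
    rw [emb_sub_emb hs]
    have h := abs_comm_col_le (m2 := m2) hn hs hM hA.le hAb hδ hCV hCD G hV hD hr x' hx' z
    refine h.trans ?_
    rw [hΦ, hK]
    have he := exp_col_le_wt (d := d) hδ hn1 x.1 z.1 x'.1
    have hpos : 0 ≤ ((n : ℝ) ^ (d + 1))⁻¹ * ((16 * ((d : ℝ) + 1) * CD + (64 * ((d : ℝ) + 1) + Ab) * CV)
        * Real.exp (2 * δ)) * Real.exp (-(δ / 2 * r)) := by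
      rw [← hK]; positivity
    calc _ = (((n : ℝ) ^ (d + 1))⁻¹ * ((16 * ((d : ℝ) + 1) * CD + (64 * ((d : ℝ) + 1) + Ab) * CV) * Real.exp (2 * δ))
          * Real.exp (-(δ / 2 * r))) * Real.exp (-(δ / 2 * (supNorm (z.1 - x'.1) / n))) := by ring
      _ ≤ (((n : ℝ) ^ (d + 1))⁻¹ * ((16 * ((d : ℝ) + 1) * CD + (64 * ((d : ℝ) + 1) + Ab) * CV) * Real.exp (2 * δ))
          * Real.exp (-(δ / 2 * r))) * (Real.exp (δ * supNorm (x.1 - z.1) / n)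
            * Real.exp (-(δ / 2 * (supNorm (x.1 - x'.1) / n)))) := mul_le_mul_of_nonneg_left he hpos
      _ = _ := by ring
  have hext := abs_ext_le_wt hs hΦ0 _ (fun y => Real.exp (δ * supNorm ((emb (hs.scale n) x).1 - y.1) / n))
    (fun y => (Real.exp_pos _).le) hw
  have hsum := abs_sum_mul_le_of_wt (fun y => (boxOpR n A m2 M0)⁻¹ (emb (hs.scale n) x) y) _ _
    (hR0 (emb (hs.scale n) x)) hΦ0 hext
  rw [hrep, abs_neg]
  calc (n : ℝ) ^ (d + 1) * |∑ y, (boxOpR n A m2 M0)⁻¹ (emb (hs.scale n) x) y *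
        B4Delta112ZeroBox.ext n M M0 s
          (B4Delta112ZeroBox.comm n A m2 M (fun z' => chi n M M0 s z'.1) fun w => G w x') y|
      ≤ (n : ℝ) ^ (d + 1) * (c₀ * Φ) := mul_le_mul_of_nonneg_left hsum hnp.le
    _ = _ := by rw [hΦ, cCore25, ← hK]; field_simp

/-- **CORE, ROW-DERIVATIVE CLAUSE**: `n^{d+1}·n|δG(x+e_μ,x′) − δG(x,x′)| ≤ c_core·e^{−(δ/2)r}·e^{−(δ/2)|x−x′|_∞/n}` for `x, x′` of margin
`r ≥ 3` and `x + e_μ ∈ □`, from the weighted DIFFERENCED-row bound of the outer Green's function and the same column-side inputs.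
[cite: Balaban1983Higgs3, (2.5) p.424] -/
theorem core_rowDiff (hn : 2 ≤ n) (hs : Fits M M0 s) (hM : ∀ i, 1 ≤ M i) {A Ab m2 δ c₀ CV CD : ℝ} (hA : 0 < A)
    (hAb : A ≤ Ab) (hm : 0 ≤ m2) (hδ : 0 ≤ δ) (hCV : 0 ≤ CV) (hCD : 0 ≤ CD)
    (hR1 : ∀ (μ : Fin (d + 1)) (y ye : ↥(boxDom (fun i => n * M0 i))), ye.1 = y.1 + Pi.single μ 1 →
      ∑ y', |(n : ℝ) * ((boxOpR n A m2 M0)⁻¹ ye y' - (boxOpR n A m2 M0)⁻¹ y y')|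
        * Real.exp (δ * supNorm (y.1 - y'.1) / n) ≤ c₀)
    (hV : ∀ w x' : ↥(boxDom (fun i => n * M i)), (1 / 2 : ℝ) * n ≤ supNorm (w.1 - x'.1) →
      (n : ℝ) ^ (d + 1) * |(boxOpR n A m2 M)⁻¹ w x'| ≤ CV * Real.exp (-(δ * (supNorm (w.1 - x'.1) / n))))
    (hD : ∀ (μ : Fin (d + 1)) (w we : ↥(boxDom (fun i => n * M i))), we.1 = w.1 + Pi.single μ 1 →
      ∀ x' : ↥(boxDom (fun i => n * M i)), (1 / 2 : ℝ) * n ≤ supNorm (w.1 - x'.1) →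
      (n : ℝ) ^ (d + 1) * ((n : ℝ) * |(boxOpR n A m2 M)⁻¹ we x' - (boxOpR n A m2 M)⁻¹ w x'|)
        ≤ CD * Real.exp (-(δ * (supNorm (w.1 - x'.1) / n))))
    {r : ℕ} (hr : 3 ≤ r) {μ : Fin (d + 1)} (x xe x' : ↥(boxDom (fun i => n * M i)))
    (hxe : xe.1 = x.1 + Pi.single μ 1) (hx : Margin n hs r x) (hx' : Margin n hs r x') :
    (n : ℝ) ^ (d + 1) * ((n : ℝ) * |dK n A m2 hs xe x' - dK n A m2 hs x x'|)
      ≤ cCore25 d c₀ Ab δ CV CD * Real.exp (-(δ / 2 * r)) * Real.exp (-(δ / 2 * (supNorm (x.1 - x'.1) / n))) := by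
  have hn1 : 1 ≤ n := by omega
  have hnR : (0 : ℝ) ≤ n := Nat.cast_nonneg n
  have hnp : (0 : ℝ) < (n : ℝ) ^ (d + 1) := by positivity
  set G := (boxOpR n A m2 M)⁻¹ with hG
  set K : ℝ := (16 * ((d : ℝ) + 1) * CD + (64 * ((d : ℝ) + 1) + Ab) * CV) * Real.exp (2 * δ) with hK
  have hK0 : 0 ≤ K := by
    rw [hK]
    have : 0 ≤ (64 * ((d : ℝ) + 1) + Ab) * CV := mul_nonneg (add_nonneg (by positivity) (hA.le.trans hAb)) hCV
    positivity
  set Φ : ℝ := ((n : ℝ) ^ (d + 1))⁻¹ * K * Real.exp (-(δ / 2 * r)) *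
    Real.exp (-(δ / 2 * (supNorm (x.1 - x'.1) / n))) with hΦ
  have hΦ0 : 0 ≤ Φ := by rw [hΦ]; positivity
  have hu : (G *ᵥ ind x') = fun w => G w x' := funext (mulVec_ind G x')
  have hsupp := ind_support hn hs hM (show 2 ≤ r by omega) hx'
  have hxxe : supNorm (x.1 - xe.1) ≤ 1 := supNorm_sub_le_one_of_mem_nbrs (mem_nbrs.2 ⟨μ, Or.inl hxe⟩)
  have hrep := kf_eq hn hA hm hs hM (ind x') hsupp x (chi_eq_one_of_margin hn hs hM (by omega) hx)
  have hrepe := kf_eq hn hA hm hs hM (ind x') hsupp xe (chi_eq_one_of_margin_nbr hn hs hM hr hx hxxe)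
  rw [← dK_eq_kf, ← hG, hu] at hrep hrepe
  set w := B4Delta112ZeroBox.ext n M M0 s
    (B4Delta112ZeroBox.comm n A m2 M (fun z' => chi n M M0 s z'.1) fun w => G w x') with hwdef
  have hdiff : (n : ℝ) * (dK n A m2 hs xe x' - dK n A m2 hs x x')
      = -∑ y, (n : ℝ) * ((boxOpR n A m2 M0)⁻¹ (emb (hs.scale n) xe) y - (boxOpR n A m2 M0)⁻¹ (emb (hs.scale n) x) y)
          * w y := by
    rw [hrep, hrepe, neg_sub_neg, ← Finset.sum_sub_distrib, Finset.mul_sum, ← Finset.sum_neg_distrib]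
    exact Finset.sum_congr rfl fun y _ => by ring
  have hwb : ∀ z, |B4Delta112ZeroBox.comm n A m2 M (fun z' => chi n M M0 s z'.1) (fun w => G w x') z|
      ≤ Real.exp (δ * supNorm ((emb (hs.scale n) x).1 - (emb (hs.scale n) z).1) / n) * Φ := by
    intro z
    rw [emb_sub_emb hs]
    have h := abs_comm_col_le (m2 := m2) hn hs hM hA.le hAb hδ hCV hCD G hV hD hr x' hx' z
    refine h.trans ?_
    rw [hΦ, hK]
    have he := exp_col_le_wt (d := d) hδ hn1 x.1 z.1 x'.1
    have hpos : 0 ≤ ((n : ℝ) ^ (d + 1))⁻¹ * ((16 * ((d : ℝ) + 1) * CD + (64 * ((d : ℝ) + 1) + Ab) * CV)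
        * Real.exp (2 * δ)) * Real.exp (-(δ / 2 * r)) := by
      rw [← hK]; positivity
    calc _ = (((n : ℝ) ^ (d + 1))⁻¹ * ((16 * ((d : ℝ) + 1) * CD + (64 * ((d : ℝ) + 1) + Ab) * CV) * Real.exp (2 * δ))
          * Real.exp (-(δ / 2 * r))) * Real.exp (-(δ / 2 * (supNorm (z.1 - x'.1) / n))) := by ring
      _ ≤ (((n : ℝ) ^ (d + 1))⁻¹ * ((16 * ((d : ℝ) + 1) * CD + (64 * ((d : ℝ) + 1) + Ab) * CV) * Real.exp (2 * δ))
          * Real.exp (-(δ / 2 * r))) * (Real.exp (δ * supNorm (x.1 - z.1) / n)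
            * Real.exp (-(δ / 2 * (supNorm (x.1 - x'.1) / n)))) := mul_le_mul_of_nonneg_left he hpos
      _ = _ := by ring
  have hext := abs_ext_le_wt hs hΦ0 _ (fun y => Real.exp (δ * supNorm ((emb (hs.scale n) x).1 - y.1) / n))
    (fun y => (Real.exp_pos _).le) hwb
  have hexe : (emb (hs.scale n) xe).1 = (emb (hs.scale n) x).1 + Pi.single μ 1 := by
    rw [emb_val, emb_val, hxe]; abel
  have hsum := abs_sum_mul_le_of_wt
    (fun y => (n : ℝ) * ((boxOpR n A m2 M0)⁻¹ (emb (hs.scale n) xe) y - (boxOpR n A m2 M0)⁻¹ (emb (hs.scale n) x) y))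
    _ _ (hR1 μ (emb (hs.scale n) x) (emb (hs.scale n) xe) hexe) hΦ0 hext
  rw [show (n : ℝ) * |dK n A m2 hs xe x' - dK n A m2 hs x x'| = |(n : ℝ) * (dK n A m2 hs xe x' - dK n A m2 hs x x')|
      by rw [abs_mul, abs_of_nonneg hnR], hdiff, abs_neg]
  calc (n : ℝ) ^ (d + 1) * |∑ y, (n : ℝ) * ((boxOpR n A m2 M0)⁻¹ (emb (hs.scale n) xe) y
        - (boxOpR n A m2 M0)⁻¹ (emb (hs.scale n) x) y) * w y|
      ≤ (n : ℝ) ^ (d + 1) * (c₀ * Φ) := mul_le_mul_of_nonneg_left hsum hnp.le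
    _ = _ := by rw [hΦ, cCore25, ← hK]; field_simp

/-- **CORE, HÖLDER CLAUSE OF THE ROW DERIVATIVE IN THE ROW VARIABLE**: for row bonds at `x₁ ≠ x₂` and a column point `x′`, all of
margin `r ≥ 3`, `(n/|x₂−x₁|_∞)^α·n^{d+1}·n|(δG(x₂+e_μ,x′) − δG(x₂,x′)) − (δG(x₁+e_μ,x′) − δG(x₁,x′))| ≤
c_core·e^{−(δ/2)r}·e^{−(δ/2)min(|x₁−x′|,|x₂−x′|)/n}`, from the weighted HÖLDER-DIFFERENCED row bound of the outer Green's function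
([B4] (1.9) at `A = 0`, `B4Thm19ZeroBoxHolder`) and the column-side inputs. [cite: Balaban1983Higgs3, (2.5) p.424] -/
theorem core_rowHolder (hn : 2 ≤ n) (hs : Fits M M0 s) (hM : ∀ i, 1 ≤ M i) {A Ab m2 δ c₀ CV CD : ℝ} (α : ℝ)
    (hA : 0 < A) (hAb : A ≤ Ab) (hm : 0 ≤ m2) (hδ : 0 ≤ δ) (hCV : 0 ≤ CV) (hCD : 0 ≤ CD)
    (hR2 : ∀ (μ : Fin (d + 1)) (y ye y' ye' : ↥(boxDom (fun i => n * M0 i))), ye.1 = y.1 + Pi.single μ 1 →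
      ye'.1 = y'.1 + Pi.single μ 1 → y'.1 ≠ y.1 →
      ∑ z, |(((n : ℝ)) / supNorm (y'.1 - y.1)) ^ α * ((n : ℝ) *
          (((boxOpR n A m2 M0)⁻¹ ye' z - (boxOpR n A m2 M0)⁻¹ y' z)
            - ((boxOpR n A m2 M0)⁻¹ ye z - (boxOpR n A m2 M0)⁻¹ y z)))|
        * Real.exp (δ * min (supNorm (y.1 - z.1)) (supNorm (y'.1 - z.1)) / n) ≤ c₀)
    (hV : ∀ w x' : ↥(boxDom (fun i => n * M i)), (1 / 2 : ℝ) * n ≤ supNorm (w.1 - x'.1) →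
      (n : ℝ) ^ (d + 1) * |(boxOpR n A m2 M)⁻¹ w x'| ≤ CV * Real.exp (-(δ * (supNorm (w.1 - x'.1) / n))))
    (hD : ∀ (μ : Fin (d + 1)) (w we : ↥(boxDom (fun i => n * M i))), we.1 = w.1 + Pi.single μ 1 →
      ∀ x' : ↥(boxDom (fun i => n * M i)), (1 / 2 : ℝ) * n ≤ supNorm (w.1 - x'.1) →
      (n : ℝ) ^ (d + 1) * ((n : ℝ) * |(boxOpR n A m2 M)⁻¹ we x' - (boxOpR n A m2 M)⁻¹ w x'|)
        ≤ CD * Real.exp (-(δ * (supNorm (w.1 - x'.1) / n))))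
    {r : ℕ} (hr : 3 ≤ r) {μ : Fin (d + 1)} (x₁ xe₁ x₂ xe₂ x' : ↥(boxDom (fun i => n * M i)))
    (hxe₁ : xe₁.1 = x₁.1 + Pi.single μ 1) (hxe₂ : xe₂.1 = x₂.1 + Pi.single μ 1) (hne : x₂.1 ≠ x₁.1)
    (hx₁ : Margin n hs r x₁) (hx₂ : Margin n hs r x₂) (hx' : Margin n hs r x') :
    ((n : ℝ) / supNorm (x₂.1 - x₁.1)) ^ α *
        ((n : ℝ) ^ (d + 1) * ((n : ℝ) * |(dK n A m2 hs xe₂ x' - dK n A m2 hs x₂ x')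
          - (dK n A m2 hs xe₁ x' - dK n A m2 hs x₁ x')|))
      ≤ cCore25 d c₀ Ab δ CV CD * Real.exp (-(δ / 2 * r)) *
        Real.exp (-(δ / 2 * (min (supNorm (x₁.1 - x'.1)) (supNorm (x₂.1 - x'.1)) / n))) := by
  have hn1 : 1 ≤ n := by omega
  have hnR : (0 : ℝ) ≤ n := Nat.cast_nonneg n
  have hnp : (0 : ℝ) < (n : ℝ) ^ (d + 1) := by positivity
  set G := (boxOpR n A m2 M)⁻¹ with hG
  set K : ℝ := (16 * ((d : ℝ) + 1) * CD + (64 * ((d : ℝ) + 1) + Ab) * CV) * Real.exp (2 * δ) with hK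
  have hK0 : 0 ≤ K := by
    rw [hK]
    have : 0 ≤ (64 * ((d : ℝ) + 1) + Ab) * CV := mul_nonneg (add_nonneg (by positivity) (hA.le.trans hAb)) hCV
    positivity
  set Φ : ℝ := ((n : ℝ) ^ (d + 1))⁻¹ * K * Real.exp (-(δ / 2 * r)) *
    Real.exp (-(δ / 2 * (min (supNorm (x₁.1 - x'.1)) (supNorm (x₂.1 - x'.1)) / n))) with hΦ
  have hΦ0 : 0 ≤ Φ := by rw [hΦ]; positivity
  set ρα : ℝ := ((n : ℝ) / supNorm (x₂.1 - x₁.1)) ^ α with hρα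
  have hρα0 : 0 ≤ ρα := Real.rpow_nonneg (div_nonneg hnR (supNorm_nonneg _)) α
  have hu : (G *ᵥ ind x') = fun w => G w x' := funext (mulVec_ind G x')
  have hsupp := ind_support hn hs hM (show 2 ≤ r by omega) hx'
  have hxxe₁ : supNorm (x₁.1 - xe₁.1) ≤ 1 := supNorm_sub_le_one_of_mem_nbrs (mem_nbrs.2 ⟨μ, Or.inl hxe₁⟩)
  have hxxe₂ : supNorm (x₂.1 - xe₂.1) ≤ 1 := supNorm_sub_le_one_of_mem_nbrs (mem_nbrs.2 ⟨μ, Or.inl hxe₂⟩)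
  have hrep₁ := kf_eq hn hA hm hs hM (ind x') hsupp x₁ (chi_eq_one_of_margin hn hs hM (by omega) hx₁)
  have hrepe₁ := kf_eq hn hA hm hs hM (ind x') hsupp xe₁ (chi_eq_one_of_margin_nbr hn hs hM hr hx₁ hxxe₁)
  have hrep₂ := kf_eq hn hA hm hs hM (ind x') hsupp x₂ (chi_eq_one_of_margin hn hs hM (by omega) hx₂)
  have hrepe₂ := kf_eq hn hA hm hs hM (ind x') hsupp xe₂ (chi_eq_one_of_margin_nbr hn hs hM hr hx₂ hxxe₂)
  rw [← dK_eq_kf, ← hG, hu] at hrep₁ hrepe₁ hrep₂ hrepe₂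
  set w := B4Delta112ZeroBox.ext n M M0 s
    (B4Delta112ZeroBox.comm n A m2 M (fun z' => chi n M M0 s z'.1) fun w => G w x') with hwdef
  set G0 := (boxOpR n A m2 M0)⁻¹ with hG0
  have hdiff : ρα * ((n : ℝ) * ((dK n A m2 hs xe₂ x' - dK n A m2 hs x₂ x') - (dK n A m2 hs xe₁ x' - dK n A m2 hs x₁ x')))
      = -∑ y, ρα * ((n : ℝ) * ((G0 (emb (hs.scale n) xe₂) y - G0 (emb (hs.scale n) x₂) y)
          - (G0 (emb (hs.scale n) xe₁) y - G0 (emb (hs.scale n) x₁) y))) * w y := by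
    rw [hrep₁, hrepe₁, hrep₂, hrepe₂, neg_sub_neg, neg_sub_neg, ← Finset.sum_sub_distrib, ← Finset.sum_sub_distrib,
      ← Finset.sum_sub_distrib, Finset.mul_sum, Finset.mul_sum, ← Finset.sum_neg_distrib]
    exact Finset.sum_congr rfl fun y _ => by ring
  have hwb : ∀ z, |B4Delta112ZeroBox.comm n A m2 M (fun z' => chi n M M0 s z'.1) (fun w => G w x') z|
      ≤ Real.exp (δ * min (supNorm ((emb (hs.scale n) x₁).1 - (emb (hs.scale n) z).1))
          (supNorm ((emb (hs.scale n) x₂).1 - (emb (hs.scale n) z).1)) / n) * Φ := by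
    intro z
    rw [emb_sub_emb hs, emb_sub_emb hs]
    have h := abs_comm_col_le (m2 := m2) hn hs hM hA.le hAb hδ hCV hCD G hV hD hr x' hx' z
    refine h.trans ?_
    rw [hΦ, hK]
    have he := exp_col_le_wt_min (d := d) hδ hn1 x₁.1 x₂.1 z.1 x'.1
    have hpos : 0 ≤ ((n : ℝ) ^ (d + 1))⁻¹ * ((16 * ((d : ℝ) + 1) * CD + (64 * ((d : ℝ) + 1) + Ab) * CV)
        * Real.exp (2 * δ)) * Real.exp (-(δ / 2 * r)) := by
      rw [← hK]; positivity
    calc _ = (((n : ℝ) ^ (d + 1))⁻¹ * ((16 * ((d : ℝ) + 1) * CD + (64 * ((d : ℝ) + 1) + Ab) * CV) * Real.exp (2 * δ))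
          * Real.exp (-(δ / 2 * r))) * Real.exp (-(δ / 2 * (supNorm (z.1 - x'.1) / n))) := by ring
      _ ≤ (((n : ℝ) ^ (d + 1))⁻¹ * ((16 * ((d : ℝ) + 1) * CD + (64 * ((d : ℝ) + 1) + Ab) * CV) * Real.exp (2 * δ))
          * Real.exp (-(δ / 2 * r))) * (Real.exp (δ * min (supNorm (x₁.1 - z.1)) (supNorm (x₂.1 - z.1)) / n)
            * Real.exp (-(δ / 2 * (min (supNorm (x₁.1 - x'.1)) (supNorm (x₂.1 - x'.1)) / n)))) :=
          mul_le_mul_of_nonneg_left he hpos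
      _ = _ := by ring
  have hext := abs_ext_le_wt hs hΦ0 _
    (fun y => Real.exp (δ * min (supNorm ((emb (hs.scale n) x₁).1 - y.1)) (supNorm ((emb (hs.scale n) x₂).1 - y.1)) / n))
    (fun y => (Real.exp_pos _).le) hwb
  have hexe₁ : (emb (hs.scale n) xe₁).1 = (emb (hs.scale n) x₁).1 + Pi.single μ 1 := by
    rw [emb_val, emb_val, hxe₁]; abel
  have hexe₂ : (emb (hs.scale n) xe₂).1 = (emb (hs.scale n) x₂).1 + Pi.single μ 1 := by
    rw [emb_val, emb_val, hxe₂]; abel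
  have hne' : (emb (hs.scale n) x₂).1 ≠ (emb (hs.scale n) x₁).1 := by
    rw [emb_val, emb_val]
    intro h
    exact hne (add_right_cancel h)
  have hR := hR2 μ (emb (hs.scale n) x₁) (emb (hs.scale n) xe₁) (emb (hs.scale n) x₂) (emb (hs.scale n) xe₂) hexe₁ hexe₂ hne'
  rw [emb_sub_emb hs, ← hρα] at hR
  have hsum := abs_sum_mul_le_of_wt
    (fun y => ρα * ((n : ℝ) * ((G0 (emb (hs.scale n) xe₂) y - G0 (emb (hs.scale n) x₂) y)
      - (G0 (emb (hs.scale n) xe₁) y - G0 (emb (hs.scale n) x₁) y)))) _ _ hR hΦ0 hext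
  rw [show ρα * ((n : ℝ) ^ (d + 1) * ((n : ℝ) * |(dK n A m2 hs xe₂ x' - dK n A m2 hs x₂ x')
        - (dK n A m2 hs xe₁ x' - dK n A m2 hs x₁ x')|))
      = (n : ℝ) ^ (d + 1) * |ρα * ((n : ℝ) * ((dK n A m2 hs xe₂ x' - dK n A m2 hs x₂ x')
        - (dK n A m2 hs xe₁ x' - dK n A m2 hs x₁ x')))| by
      rw [abs_mul, abs_mul, abs_of_nonneg hρα0, abs_of_nonneg hnR]; ring, hdiff, abs_neg]
  calc (n : ℝ) ^ (d + 1) * |∑ y, ρα * ((n : ℝ) * ((G0 (emb (hs.scale n) xe₂) y - G0 (emb (hs.scale n) x₂) y)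
        - (G0 (emb (hs.scale n) xe₁) y - G0 (emb (hs.scale n) x₁) y))) * w y|
      ≤ (n : ℝ) ^ (d + 1) * (c₀ * Φ) := mul_le_mul_of_nonneg_left hsum hnp.le
    _ = _ := by rw [hΦ, cCore25, ← hK]; field_simp

/-- **CORE, MIXED CLAUSE**: for a row bond at `x` and a column bond at `x′`, both of margin `r ≥ 3`,
`n^{d+1}·n²|(δG(x+e_μ,x′+e_ν) − δG(x,x′+e_ν)) − (δG(x+e_μ,x′) − δG(x,x′))| ≤ c_core·e^{−(δ/2)r}·e^{−(δ/2)|x−x′|_∞/n}`, from the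
weighted differenced-row bound of the outer Green's function and the COLUMN-DERIVATIVE and MIXED kernel clauses of the inner one
(the commutator applied to `n(G(·,x′+e_ν) − G(·,x′))`). [cite: Balaban1983Higgs3, (2.5) p.424] -/
theorem core_mixed (hn : 2 ≤ n) (hs : Fits M M0 s) (hM : ∀ i, 1 ≤ M i) {A Ab m2 δ c₀ CD' CM : ℝ} (hA : 0 < A)
    (hAb : A ≤ Ab) (hm : 0 ≤ m2) (hδ : 0 ≤ δ) (hCD' : 0 ≤ CD') (hCM : 0 ≤ CM)
    (hR1 : ∀ (μ : Fin (d + 1)) (y ye : ↥(boxDom (fun i => n * M0 i))), ye.1 = y.1 + Pi.single μ 1 →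
      ∑ y', |(n : ℝ) * ((boxOpR n A m2 M0)⁻¹ ye y' - (boxOpR n A m2 M0)⁻¹ y y')|
        * Real.exp (δ * supNorm (y.1 - y'.1) / n) ≤ c₀)
    (hD' : ∀ (w : ↥(boxDom (fun i => n * M i))) (ν : Fin (d + 1)) (x' xe' : ↥(boxDom (fun i => n * M i))),
      xe'.1 = x'.1 + Pi.single ν 1 → (1 / 2 : ℝ) * n ≤ supNorm (w.1 - x'.1) →
      (n : ℝ) ^ (d + 1) * ((n : ℝ) * |(boxOpR n A m2 M)⁻¹ w xe' - (boxOpR n A m2 M)⁻¹ w x'|)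
        ≤ CD' * Real.exp (-(δ * (supNorm (w.1 - x'.1) / n))))
    (hMx : ∀ (μ ν : Fin (d + 1)) (w we : ↥(boxDom (fun i => n * M i))), we.1 = w.1 + Pi.single μ 1 →
      ∀ (x' xe' : ↥(boxDom (fun i => n * M i))), xe'.1 = x'.1 + Pi.single ν 1 →
      (1 / 2 : ℝ) * n ≤ supNorm (w.1 - x'.1) →
      (n : ℝ) ^ (d + 1) * ((n : ℝ) ^ 2 * |((boxOpR n A m2 M)⁻¹ we xe' - (boxOpR n A m2 M)⁻¹ w xe')
        - ((boxOpR n A m2 M)⁻¹ we x' - (boxOpR n A m2 M)⁻¹ w x')|)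
        ≤ CM * Real.exp (-(δ * (supNorm (w.1 - x'.1) / n))))
    {r : ℕ} (hr : 3 ≤ r) {μ ν : Fin (d + 1)} (x xe x' xe' : ↥(boxDom (fun i => n * M i)))
    (hxe : xe.1 = x.1 + Pi.single μ 1) (hxe' : xe'.1 = x'.1 + Pi.single ν 1)
    (hx : Margin n hs r x) (hx' : Margin n hs r x') :
    (n : ℝ) ^ (d + 1) * ((n : ℝ) ^ 2 * |(dK n A m2 hs xe xe' - dK n A m2 hs x xe')
        - (dK n A m2 hs xe x' - dK n A m2 hs x x')|)
      ≤ cCore25 d c₀ Ab δ CD' CM * Real.exp (-(δ / 2 * r)) * Real.exp (-(δ / 2 * (supNorm (x.1 - x'.1) / n))) := by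
  have hn1 : 1 ≤ n := by omega
  have hnR : (0 : ℝ) ≤ n := Nat.cast_nonneg n
  have hnp : (0 : ℝ) < (n : ℝ) ^ (d + 1) := by positivity
  set G := (boxOpR n A m2 M)⁻¹ with hG
  set K : ℝ := (16 * ((d : ℝ) + 1) * CM + (64 * ((d : ℝ) + 1) + Ab) * CD') * Real.exp (2 * δ) with hK
  have hK0 : 0 ≤ K := by
    rw [hK]
    have : 0 ≤ (64 * ((d : ℝ) + 1) + Ab) * CD' := mul_nonneg (add_nonneg (by positivity) (hA.le.trans hAb)) hCD'
    positivity
  set Φ : ℝ := ((n : ℝ) ^ (d + 1))⁻¹ * K * Real.exp (-(δ / 2 * r)) *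
    Real.exp (-(δ / 2 * (supNorm (x.1 - x'.1) / n))) with hΦ
  have hΦ0 : 0 ≤ Φ := by rw [hΦ]; positivity
  have hu : (G *ᵥ indDiff n x' xe') = fun w => (n : ℝ) * (G w xe' - G w x') := funext (mulVec_indDiff G x' xe')
  have hsupp := indDiff_support hn hs hM hr hxe' hx'
  have hxxe : supNorm (x.1 - xe.1) ≤ 1 := supNorm_sub_le_one_of_mem_nbrs (mem_nbrs.2 ⟨μ, Or.inl hxe⟩)
  have hrep := kf_eq hn hA hm hs hM (indDiff n x' xe') hsupp x (chi_eq_one_of_margin hn hs hM (by omega) hx)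
  have hrepe := kf_eq hn hA hm hs hM (indDiff n x' xe') hsupp xe (chi_eq_one_of_margin_nbr hn hs hM hr hx hxxe)
  rw [← colDiff_eq_kf, ← hG, hu] at hrep hrepe
  set w := B4Delta112ZeroBox.ext n M M0 s
    (B4Delta112ZeroBox.comm n A m2 M (fun z' => chi n M M0 s z'.1) fun w => (n : ℝ) * (G w xe' - G w x')) with hwdef
  set G0 := (boxOpR n A m2 M0)⁻¹ with hG0
  have hdiff : (n : ℝ) ^ 2 * ((dK n A m2 hs xe xe' - dK n A m2 hs x xe') - (dK n A m2 hs xe x' - dK n A m2 hs x x'))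
      = -∑ y, (n : ℝ) * (G0 (emb (hs.scale n) xe) y - G0 (emb (hs.scale n) x) y) * w y := by
    rw [show (n : ℝ) ^ 2 * ((dK n A m2 hs xe xe' - dK n A m2 hs x xe') - (dK n A m2 hs xe x' - dK n A m2 hs x x'))
        = (n : ℝ) * ((n : ℝ) * (dK n A m2 hs xe xe' - dK n A m2 hs xe x')
          - (n : ℝ) * (dK n A m2 hs x xe' - dK n A m2 hs x x')) by ring, hrep, hrepe, neg_sub_neg,
      ← Finset.sum_sub_distrib, Finset.mul_sum, ← Finset.sum_neg_distrib]
    exact Finset.sum_congr rfl fun y _ => by ring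
  have hwb : ∀ z, |B4Delta112ZeroBox.comm n A m2 M (fun z' => chi n M M0 s z'.1)
      (fun w => (n : ℝ) * (G w xe' - G w x')) z|
      ≤ Real.exp (δ * supNorm ((emb (hs.scale n) x).1 - (emb (hs.scale n) z).1) / n) * Φ := by
    intro z
    rw [emb_sub_emb hs]
    have h := abs_comm_colDiff_le (m2 := m2) hn hs hM hA.le hAb hδ hCD' hCM G hD' hMx hr x' xe' hxe' hx' z
    refine h.trans ?_
    rw [hΦ, hK]
    have he := exp_col_le_wt (d := d) hδ hn1 x.1 z.1 x'.1
    have hpos : 0 ≤ ((n : ℝ) ^ (d + 1))⁻¹ * ((16 * ((d : ℝ) + 1) * CM + (64 * ((d : ℝ) + 1) + Ab) * CD')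
        * Real.exp (2 * δ)) * Real.exp (-(δ / 2 * r)) := by
      rw [← hK]; positivity
    calc _ = (((n : ℝ) ^ (d + 1))⁻¹ * ((16 * ((d : ℝ) + 1) * CM + (64 * ((d : ℝ) + 1) + Ab) * CD') * Real.exp (2 * δ))
          * Real.exp (-(δ / 2 * r))) * Real.exp (-(δ / 2 * (supNorm (z.1 - x'.1) / n))) := by ring
      _ ≤ (((n : ℝ) ^ (d + 1))⁻¹ * ((16 * ((d : ℝ) + 1) * CM + (64 * ((d : ℝ) + 1) + Ab) * CD') * Real.exp (2 * δ))
          * Real.exp (-(δ / 2 * r))) * (Real.exp (δ * supNorm (x.1 - z.1) / n)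
            * Real.exp (-(δ / 2 * (supNorm (x.1 - x'.1) / n)))) := mul_le_mul_of_nonneg_left he hpos
      _ = _ := by ring
  have hext := abs_ext_le_wt hs hΦ0 _ (fun y => Real.exp (δ * supNorm ((emb (hs.scale n) x).1 - y.1) / n))
    (fun y => (Real.exp_pos _).le) hwb
  have hexe : (emb (hs.scale n) xe).1 = (emb (hs.scale n) x).1 + Pi.single μ 1 := by
    rw [emb_val, emb_val, hxe]; abel
  have hsum := abs_sum_mul_le_of_wt
    (fun y => (n : ℝ) * (G0 (emb (hs.scale n) xe) y - G0 (emb (hs.scale n) x) y))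
    _ _ (hR1 μ (emb (hs.scale n) x) (emb (hs.scale n) xe) hexe) hΦ0 hext
  rw [show (n : ℝ) ^ 2 * |(dK n A m2 hs xe xe' - dK n A m2 hs x xe') - (dK n A m2 hs xe x' - dK n A m2 hs x x')|
      = |(n : ℝ) ^ 2 * ((dK n A m2 hs xe xe' - dK n A m2 hs x xe') - (dK n A m2 hs xe x' - dK n A m2 hs x x'))| by
      rw [abs_mul, abs_of_nonneg (pow_nonneg hnR 2)], hdiff, abs_neg]
  calc (n : ℝ) ^ (d + 1) * |∑ y, (n : ℝ) * (G0 (emb (hs.scale n) xe) y - G0 (emb (hs.scale n) x) y) * w y|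
      ≤ (n : ℝ) ^ (d + 1) * (c₀ * Φ) := mul_le_mul_of_nonneg_left hsum hnp.le
    _ = _ := by rw [hΦ, cCore25, ← hK]; field_simp

end Core

/-! ## §7 The six kernel clauses of `δG_k(Ω,Ω₂,0)` for the zero-field nested-box instance -/

section Instance

variable {ℓ k : ℕ} {M M0 : Fin (d + 1) → ℕ} {s : Fin (d + 1) → ℤ}

/-- **`δG_k(Ω,Ω₂,0)(x,x′)` FOR THE INSTANCE, matrix units**: `G_k(□₀,0) = Gfine ℓ k M₀ k a m2` at the translated points minus
`G_k(□,0) = Gfine ℓ k M k a m2` (scale `k`, `n = L^k` fine points per unit, running `a_k = B1.aSeq a L k`); the physical kernel of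
(2.5)/(2.6) is `η^{−(d+1)}·dGk = (L^k)^{d+1}·dGk`. [cite: Balaban1983Higgs3, (2.5) p.424] -/
def dGk (ℓ k : ℕ) (hs : Fits M M0 s) (a m2 : ℝ) (x x' : ↥(boxDom (Nf ℓ k M))) : ℝ :=
  Gfine ℓ k M0 k a m2 (emb (hs.scale ((ℓ + 1) ^ k)) x) (emb (hs.scale ((ℓ + 1) ^ k)) x') - Gfine ℓ k M k a m2 x x'

/-- the instance kernel is `dK` at `n = L^k`, `A = a_k`. [cite: Balaban1983Higgs3, (2.5) p.424] -/
theorem dGk_eq_dK (hs : Fits M M0 s) (a m2 : ℝ) (x x' : ↥(boxDom (Nf ℓ k M))) :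
    dGk ℓ k hs a m2 x x' = dK ((ℓ + 1) ^ k) (B1.aSeq a ((ℓ : ℝ) + 1) k) m2 hs x x' := by
  unfold dGk dK Gfine
  rw [fineOp_top, fineOp_top]

/-- the instance kernel is symmetric. [cite: Balaban1983Higgs3, (2.5) p.424] -/
theorem dGk_comm (hs : Fits M M0 s) (a m2 : ℝ) (x x' : ↥(boxDom (Nf ℓ k M))) :
    dGk ℓ k hs a m2 x x' = dGk ℓ k hs a m2 x' x := by
  rw [dGk_eq_dK, dGk_eq_dK, dK_comm]

end Instance

/-- kernel: weakening the rate of a pointwise clause. [folklore] -/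
private theorem wk_pt {C δ₁ δ p t : ℝ} (hC : 0 ≤ C) (h : δ ≤ δ₁) (hp : 0 ≤ p)
    (ht : t ≤ C * Real.exp (-(δ₁ * p))) : t ≤ C * Real.exp (-(δ * p)) :=
  ht.trans (mul_le_mul_of_nonneg_left (exp_rate_mono h hp) hC)

/-- kernel: weakening the rate of a weighted row bound. [folklore] -/
private theorem wk_row {ι : Type*} [Fintype ι] (g W : ι → ℝ) {δ δ₁ c : ℝ} (n : ℕ) (h : δ ≤ δ₁) (hW : ∀ y, 0 ≤ W y)
    (hs : ∑ y, |g y| * Real.exp (δ₁ * W y / n) ≤ c) : ∑ y, |g y| * Real.exp (δ * W y / n) ≤ c :=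
  (Finset.sum_le_sum fun y _ => mul_le_mul_of_nonneg_left (Real.exp_le_exp.2
    (div_le_div_of_nonneg_right (mul_le_mul_of_nonneg_right h (hW y)) (Nat.cast_nonneg n))) (abs_nonneg _)).trans hs

/-- kernel: the core constant is positive when the height of the row bound and the derivative constant are. [folklore] -/
private theorem cCore25_pos (d : ℕ) {c₀ Ab δ Cu Cdu : ℝ} (hc₀ : 0 < c₀) (hAb : 0 ≤ Ab) (hCu : 0 ≤ Cu) (hCdu : 0 < Cdu) :
    0 < cCore25 d c₀ Ab δ Cu Cdu := by
  unfold cCore25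
  have h1 : 0 < 16 * ((d : ℝ) + 1) * Cdu := by positivity
  have h2 : 0 ≤ (64 * ((d : ℝ) + 1) + Ab) * Cu := by positivity
  have h3 : 0 < 16 * ((d : ℝ) + 1) * Cdu + (64 * ((d : ℝ) + 1) + Ab) * Cu := by linarith
  positivity

/-- **B3 (2.5), kernel level, VALUE — the zero-field nested-box kernel `δG_k(Ω,Ω₂,0)` is uniformly small and smooth away from
`Ω∖Ω₂`.**  There are `δ₀ > 0`, `C > 0` (on `d`, `L`, the window) such that for every `k ≥ 1` (`η = L^{−k}`), window point, nested pair
of boxes `Ω₂ = □ ⊂ Ω = □₀`, margin `r ≥ 3` and fine points `x, x′ ∈ □` of margin `r`: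
`η^{−(d+1)}|δG_k(Ω,Ω₂,0;x,x′)| ≤ C·e^{−δ₀r}·e^{−δ₀·η|x−x′|_∞}` — the sup-norm part of (2.5)
`‖hδG_k(Ω,Ω₂,B̃)h′‖_{1,α} ≤ O(e^{−δ₀dist})e^{−δ₀dist(supp h,supp h′)}` for the instance, INCLUDING coincident cubes.  Print: *"In the
estimates we treat them as external fields and we use the inequalities: ‖h(an operator δG_k(Ω,Ω₂,B̃) or (1.16))h′‖_{1,α} ≤
O(e^{−δ₀dist(Ω₂,∂Ω)} or (e(L^kε)p(L^kε))^{n+n′})e^{−δ₀dist(supp h,supp h′)}, (2.5)"*; p. 414: *"This estimate follows easily from the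
properties of the propagators G_k(Ω,A) proved in the next paper."* [cite: Balaban1983Higgs3, (2.5) p.424] -/
theorem abs_dGk_le (d ℓ : ℕ) (hℓ : 1 ≤ ℓ) (amin aplus m2plus : ℝ) (ha : 0 < amin) :
    ∃ δ₀ C : ℝ, 0 < δ₀ ∧ 0 < C ∧ ∀ (k : ℕ), 1 ≤ k → ∀ (a m2 : ℝ), amin ≤ a → a ≤ aplus → 0 ≤ m2 → m2 ≤ m2plus →
      ∀ (M M0 : Fin (d + 1) → ℕ) (s : Fin (d + 1) → ℤ) (hs : Fits M M0 s), (∀ i, 1 ≤ M i) →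
      ∀ (r : ℕ), 3 ≤ r → ∀ (x x' : ↥(boxDom (Nf ℓ k M))),
        Margin ((ℓ + 1) ^ k) hs r x → Margin ((ℓ + 1) ^ k) hs r x' →
        ((((ℓ + 1) ^ k : ℕ)) : ℝ) ^ (d + 1) * |dGk ℓ k hs a m2 x x'|
          ≤ C * Real.exp (-(δ₀ * r)) * Real.exp (-(δ₀ * (supNorm (x.1 - x'.1) / ((((ℓ + 1) ^ k : ℕ)) : ℝ)))) := by
  obtain ⟨δa, ca, hδa, hca, hRa⟩ := thm110_zero_box_roww d ℓ hℓ amin aplus m2plus ha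
  obtain ⟨δv, CV, hδv, hCV, hV⟩ := abs_Gk_sep_le d ℓ hℓ amin aplus m2plus ha (ρ := 1 / 2) (by norm_num)
  obtain ⟨δd, CD, hδd, hCD, hD⟩ := abs_GkDiff_sep_le d ℓ hℓ amin aplus m2plus ha (ρ := 1 / 2) (by norm_num)
  set δ : ℝ := min δa (min δv δd) with hδdef
  have hδ : 0 < δ := lt_min hδa (lt_min hδv hδd)
  have la : δ ≤ δa := min_le_left _ _
  have lv : δ ≤ δv := (min_le_right _ _).trans (min_le_left _ _)
  have ld : δ ≤ δd := (min_le_right _ _).trans (min_le_right _ _)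
  refine ⟨δ / 2, cCore25 d ca |aplus| δ CV CD, half_pos hδ, cCore25_pos d hca (abs_nonneg _) hCV.le hCD, ?_⟩
  intro k hk a m2 h1 h2 h3 h4 M M0 s hs hM r hr x x' hx hx'
  have hn2 : 2 ≤ (ℓ + 1) ^ k := B4Delta112ZeroBox.two_le_pow hℓ hk
  have hL := one_lt_L_real hℓ
  have ha0 : 0 < a := ha.trans_le h1
  have hA : 0 < B1.aSeq a ((ℓ : ℝ) + 1) k := B1.aSeq_pos ha0 hL hk
  have hAb : B1.aSeq a ((ℓ : ℝ) + 1) k ≤ |aplus| := ((B1.aSeq_le ha0 hL k hk).trans h2).trans (le_abs_self _)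
  have hM0 : ∀ i, 1 ≤ M0 i := fun i => hs.one_le hM i
  have hG : Gfine ℓ k M k a m2 = (boxOpR ((ℓ + 1) ^ k) (B1.aSeq a ((ℓ : ℝ) + 1) k) m2 M)⁻¹ := by
    unfold Gfine; rw [fineOp_top]
  have hnn : ∀ z : Fin (d + 1) → ℤ, 0 ≤ supNorm z / ((((ℓ + 1) ^ k : ℕ)) : ℝ) := fun z =>
    div_nonneg (supNorm_nonneg _) (Nat.cast_nonneg _)
  have hcore := core_value (d := d) hn2 hs hM hA hAb h3 hδ.le hCV.le hCD.le
    (fun y => wk_row _ _ ((ℓ + 1) ^ k) la (fun y' => supNorm_nonneg _) (hRa k hk a m2 h1 h2 h3 h4 M0 hM0 y))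
    (fun w x' hsep => by
      rw [← hG]
      exact wk_pt hCV.le lv (hnn _) (hV k hk a m2 h1 h2 h3 h4 M hM w x' hsep))
    (fun μ w we hwe x' hsep => by
      rw [← hG]
      exact wk_pt hCD.le ld (hnn _) (hD k hk a m2 h1 h2 h3 h4 M hM μ w we hwe x' hsep))
    hr x x' hx hx'
  rw [dGk_eq_dK]
  exact hcore

/-- **B3 (2.5), kernel level, DERIVATIVE IN THE ROW VARIABLE**: `η^{−(d+1)}·|(∂^η_μδG_k)(x,x′)| =
(L^k)^{d+1}·L^k·|δG_k(x+e_μ,x′) − δG_k(x,x′)| ≤ C·e^{−δ₀r}·e^{−δ₀·η|x−x′|_∞}` for `x, x′` of margin `r ≥ 3` and `x + e_μ ∈ □`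
([B4] (1.10) differenced rows at `A = 0` for the outer box, `B4Thm110ZeroBoxDeriv`, against the column side).
[cite: Balaban1983Higgs3, (2.5) p.424] -/
theorem abs_dGkDiff_le (d ℓ : ℕ) (hℓ : 1 ≤ ℓ) (amin aplus m2plus : ℝ) (ha : 0 < amin) :
    ∃ δ₀ C : ℝ, 0 < δ₀ ∧ 0 < C ∧ ∀ (k : ℕ), 1 ≤ k → ∀ (a m2 : ℝ), amin ≤ a → a ≤ aplus → 0 ≤ m2 → m2 ≤ m2plus →
      ∀ (M M0 : Fin (d + 1) → ℕ) (s : Fin (d + 1) → ℤ) (hs : Fits M M0 s), (∀ i, 1 ≤ M i) →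
      ∀ (r : ℕ), 3 ≤ r → ∀ (μ : Fin (d + 1)) (x xe : ↥(boxDom (Nf ℓ k M))), xe.1 = x.1 + Pi.single μ 1 →
      ∀ (x' : ↥(boxDom (Nf ℓ k M))), Margin ((ℓ + 1) ^ k) hs r x → Margin ((ℓ + 1) ^ k) hs r x' →
        ((((ℓ + 1) ^ k : ℕ)) : ℝ) ^ (d + 1) * (((((ℓ + 1) ^ k : ℕ)) : ℝ) * |dGk ℓ k hs a m2 xe x' - dGk ℓ k hs a m2 x x'|)
          ≤ C * Real.exp (-(δ₀ * r)) * Real.exp (-(δ₀ * (supNorm (x.1 - x'.1) / ((((ℓ + 1) ^ k : ℕ)) : ℝ)))) := by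
  obtain ⟨δa, ca, hδa, hca, hRa⟩ := thm110_zero_box_deriv_roww d ℓ hℓ amin aplus m2plus ha
  obtain ⟨δv, CV, hδv, hCV, hV⟩ := abs_Gk_sep_le d ℓ hℓ amin aplus m2plus ha (ρ := 1 / 2) (by norm_num)
  obtain ⟨δd, CD, hδd, hCD, hD⟩ := abs_GkDiff_sep_le d ℓ hℓ amin aplus m2plus ha (ρ := 1 / 2) (by norm_num)
  set δ : ℝ := min δa (min δv δd) with hδdef
  have hδ : 0 < δ := lt_min hδa (lt_min hδv hδd)
  have la : δ ≤ δa := min_le_left _ _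
  have lv : δ ≤ δv := (min_le_right _ _).trans (min_le_left _ _)
  have ld : δ ≤ δd := (min_le_right _ _).trans (min_le_right _ _)
  refine ⟨δ / 2, cCore25 d ca |aplus| δ CV CD, half_pos hδ, cCore25_pos d hca (abs_nonneg _) hCV.le hCD, ?_⟩
  intro k hk a m2 h1 h2 h3 h4 M M0 s hs hM r hr μ x xe hxe x' hx hx'
  have hn2 : 2 ≤ (ℓ + 1) ^ k := B4Delta112ZeroBox.two_le_pow hℓ hk
  have hL := one_lt_L_real hℓ
  have ha0 : 0 < a := ha.trans_le h1
  have hA : 0 < B1.aSeq a ((ℓ : ℝ) + 1) k := B1.aSeq_pos ha0 hL hk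
  have hAb : B1.aSeq a ((ℓ : ℝ) + 1) k ≤ |aplus| := ((B1.aSeq_le ha0 hL k hk).trans h2).trans (le_abs_self _)
  have hM0 : ∀ i, 1 ≤ M0 i := fun i => hs.one_le hM i
  have hG : Gfine ℓ k M k a m2 = (boxOpR ((ℓ + 1) ^ k) (B1.aSeq a ((ℓ : ℝ) + 1) k) m2 M)⁻¹ := by
    unfold Gfine; rw [fineOp_top]
  have hnn : ∀ z : Fin (d + 1) → ℤ, 0 ≤ supNorm z / ((((ℓ + 1) ^ k : ℕ)) : ℝ) := fun z =>
    div_nonneg (supNorm_nonneg _) (Nat.cast_nonneg _)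
  have hcore := core_rowDiff (d := d) hn2 hs hM hA hAb h3 hδ.le hCV.le hCD.le
    (fun μ y ye hye => wk_row _ _ ((ℓ + 1) ^ k) la (fun y' => supNorm_nonneg _)
      (hRa k hk a m2 h1 h2 h3 h4 M0 hM0 μ y ye hye))
    (fun w x' hsep => by
      rw [← hG]
      exact wk_pt hCV.le lv (hnn _) (hV k hk a m2 h1 h2 h3 h4 M hM w x' hsep))
    (fun μ w we hwe x' hsep => by
      rw [← hG]
      exact wk_pt hCD.le ld (hnn _) (hD k hk a m2 h1 h2 h3 h4 M hM μ w we hwe x' hsep))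
    hr x xe x' hxe hx hx'
  rw [dGk_eq_dK, dGk_eq_dK]
  exact hcore

/-- **B3 (2.5), kernel level, DERIVATIVE IN THE COLUMN VARIABLE**, by the symmetry of `δG_k`: `(L^k)^{d+1}·L^k·|δG_k(x,x′+e_ν) −
δG_k(x,x′)| ≤ C·e^{−δ₀r}·e^{−δ₀·η|x−x′|_∞}` for `x, x′` of margin `r ≥ 3`. [cite: Balaban1983Higgs3, (2.5) p.424] -/
theorem abs_dGkDiff'_le (d ℓ : ℕ) (hℓ : 1 ≤ ℓ) (amin aplus m2plus : ℝ) (ha : 0 < amin) :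
    ∃ δ₀ C : ℝ, 0 < δ₀ ∧ 0 < C ∧ ∀ (k : ℕ), 1 ≤ k → ∀ (a m2 : ℝ), amin ≤ a → a ≤ aplus → 0 ≤ m2 → m2 ≤ m2plus →
      ∀ (M M0 : Fin (d + 1) → ℕ) (s : Fin (d + 1) → ℤ) (hs : Fits M M0 s), (∀ i, 1 ≤ M i) →
      ∀ (r : ℕ), 3 ≤ r → ∀ (x : ↥(boxDom (Nf ℓ k M))) (ν : Fin (d + 1)) (x' xe' : ↥(boxDom (Nf ℓ k M))),
      xe'.1 = x'.1 + Pi.single ν 1 → Margin ((ℓ + 1) ^ k) hs r x → Margin ((ℓ + 1) ^ k) hs r x' →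
        ((((ℓ + 1) ^ k : ℕ)) : ℝ) ^ (d + 1) * (((((ℓ + 1) ^ k : ℕ)) : ℝ) * |dGk ℓ k hs a m2 x xe' - dGk ℓ k hs a m2 x x'|)
          ≤ C * Real.exp (-(δ₀ * r)) * Real.exp (-(δ₀ * (supNorm (x.1 - x'.1) / ((((ℓ + 1) ^ k : ℕ)) : ℝ)))) := by
  obtain ⟨δ₀, C, hδ₀, hC, h⟩ := abs_dGkDiff_le d ℓ hℓ amin aplus m2plus ha
  refine ⟨δ₀, C, hδ₀, hC, ?_⟩
  intro k hk a m2 h1 h2 h3 h4 M M0 s hs hM r hr x ν x' xe' hxe' hx hx'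
  have h' := h k hk a m2 h1 h2 h3 h4 M M0 s hs hM r hr ν x' xe' hxe' x hx' hx
  rw [dGk_comm hs a m2 xe' x, dGk_comm hs a m2 x' x, supNorm_sub_comm] at h'
  exact h'

/-- **B3 (2.5), kernel level, HÖLDER QUOTIENT OF THE ROW DERIVATIVE IN THE ROW VARIABLE** (per `0 ≤ α < 1`): for row bonds at
`x₁ ≠ x₂` and a column point `x′`, all of margin `r ≥ 3`,
`(η|x₂−x₁|_∞)^{−α}·η^{−(d+1)}|(∂^η_μδG_k)(x₂,x′) − (∂^η_μδG_k)(x₁,x′)| ≤ C·e^{−δ₀r}·e^{−δ₀·η·min(|x₁−x′|_∞,|x₂−x′|_∞)}`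
(«This applies also to Hölder norms», (2.11); [B4] (1.9) Hölder-differenced rows at `A = 0` for the outer box,
`B4Thm19ZeroBoxHolder`, «c₀ on α also»). [cite: Balaban1983Higgs3, (2.5) p.424] -/
theorem abs_dGkDD_le (d ℓ : ℕ) (hℓ : 1 ≤ ℓ) (amin aplus m2plus : ℝ) (ha : 0 < amin) {α : ℝ} (hα0 : 0 ≤ α)
    (hα1 : α < 1) :
    ∃ δ₀ C : ℝ, 0 < δ₀ ∧ 0 < C ∧ ∀ (k : ℕ), 1 ≤ k → ∀ (a m2 : ℝ), amin ≤ a → a ≤ aplus → 0 ≤ m2 → m2 ≤ m2plus →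
      ∀ (M M0 : Fin (d + 1) → ℕ) (s : Fin (d + 1) → ℤ) (hs : Fits M M0 s), (∀ i, 1 ≤ M i) →
      ∀ (r : ℕ), 3 ≤ r → ∀ (μ : Fin (d + 1)) (x₁ xe₁ x₂ xe₂ : ↥(boxDom (Nf ℓ k M))), xe₁.1 = x₁.1 + Pi.single μ 1 →
        xe₂.1 = x₂.1 + Pi.single μ 1 → x₂.1 ≠ x₁.1 → ∀ (x' : ↥(boxDom (Nf ℓ k M))),
        Margin ((ℓ + 1) ^ k) hs r x₁ → Margin ((ℓ + 1) ^ k) hs r x₂ → Margin ((ℓ + 1) ^ k) hs r x' →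
        ((((ℓ + 1) ^ k : ℕ) : ℝ) / supNorm (x₂.1 - x₁.1)) ^ α *
            (((((ℓ + 1) ^ k : ℕ)) : ℝ) ^ (d + 1) *
              ((((ℓ + 1) ^ k : ℕ) : ℝ) * |(dGk ℓ k hs a m2 xe₂ x' - dGk ℓ k hs a m2 x₂ x')
                - (dGk ℓ k hs a m2 xe₁ x' - dGk ℓ k hs a m2 x₁ x')|))
          ≤ C * Real.exp (-(δ₀ * r)) *
            Real.exp (-(δ₀ * (min (supNorm (x₁.1 - x'.1)) (supNorm (x₂.1 - x'.1)) / ((((ℓ + 1) ^ k : ℕ)) : ℝ)))) := by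
  obtain ⟨δa, ca, hδa, hca, hRa⟩ := thm19_zero_box_holder_roww d ℓ hℓ amin aplus m2plus ha α hα0 hα1
  obtain ⟨δv, CV, hδv, hCV, hV⟩ := abs_Gk_sep_le d ℓ hℓ amin aplus m2plus ha (ρ := 1 / 2) (by norm_num)
  obtain ⟨δd, CD, hδd, hCD, hD⟩ := abs_GkDiff_sep_le d ℓ hℓ amin aplus m2plus ha (ρ := 1 / 2) (by norm_num)
  set δ : ℝ := min δa (min δv δd) with hδdef
  have hδ : 0 < δ := lt_min hδa (lt_min hδv hδd)
  have la : δ ≤ δa := min_le_left _ _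
  have lv : δ ≤ δv := (min_le_right _ _).trans (min_le_left _ _)
  have ld : δ ≤ δd := (min_le_right _ _).trans (min_le_right _ _)
  refine ⟨δ / 2, cCore25 d ca |aplus| δ CV CD, half_pos hδ, cCore25_pos d hca (abs_nonneg _) hCV.le hCD, ?_⟩
  intro k hk a m2 h1 h2 h3 h4 M M0 s hs hM r hr μ x₁ xe₁ x₂ xe₂ hxe₁ hxe₂ hne x' hx₁ hx₂ hx'
  have hn2 : 2 ≤ (ℓ + 1) ^ k := B4Delta112ZeroBox.two_le_pow hℓ hk
  have hL := one_lt_L_real hℓ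
  have ha0 : 0 < a := ha.trans_le h1
  have hA : 0 < B1.aSeq a ((ℓ : ℝ) + 1) k := B1.aSeq_pos ha0 hL hk
  have hAb : B1.aSeq a ((ℓ : ℝ) + 1) k ≤ |aplus| := ((B1.aSeq_le ha0 hL k hk).trans h2).trans (le_abs_self _)
  have hM0 : ∀ i, 1 ≤ M0 i := fun i => hs.one_le hM i
  have hG : Gfine ℓ k M k a m2 = (boxOpR ((ℓ + 1) ^ k) (B1.aSeq a ((ℓ : ℝ) + 1) k) m2 M)⁻¹ := by
    unfold Gfine; rw [fineOp_top]
  have hnn : ∀ z : Fin (d + 1) → ℤ, 0 ≤ supNorm z / ((((ℓ + 1) ^ k : ℕ)) : ℝ) := fun z =>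
    div_nonneg (supNorm_nonneg _) (Nat.cast_nonneg _)
  have hcore := core_rowHolder (d := d) hn2 hs hM α hA hAb h3 hδ.le hCV.le hCD.le
    (fun μ y ye y' ye' hye hye' hne' => wk_row _ _ ((ℓ + 1) ^ k) la
      (fun z => le_min (supNorm_nonneg _) (supNorm_nonneg _))
      (hRa k hk a m2 h1 h2 h3 h4 M0 hM0 μ y ye y' ye' hye hye' hne'))
    (fun w x' hsep => by
      rw [← hG]
      exact wk_pt hCV.le lv (hnn _) (hV k hk a m2 h1 h2 h3 h4 M hM w x' hsep))
    (fun μ w we hwe x' hsep => by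
      rw [← hG]
      exact wk_pt hCD.le ld (hnn _) (hD k hk a m2 h1 h2 h3 h4 M hM μ w we hwe x' hsep))
    hr x₁ xe₁ x₂ xe₂ x' hxe₁ hxe₂ hne hx₁ hx₂ hx'
  rw [dGk_eq_dK, dGk_eq_dK, dGk_eq_dK, dGk_eq_dK]
  exact hcore

/-- **B3 (2.5), kernel level, HÖLDER QUOTIENT OF THE COLUMN DERIVATIVE IN THE COLUMN VARIABLE**, by the symmetry of `δG_k`
(per `0 ≤ α < 1`). [cite: Balaban1983Higgs3, (2.5) p.424] -/
theorem abs_dGkDD'_le (d ℓ : ℕ) (hℓ : 1 ≤ ℓ) (amin aplus m2plus : ℝ) (ha : 0 < amin) {α : ℝ} (hα0 : 0 ≤ α)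
    (hα1 : α < 1) :
    ∃ δ₀ C : ℝ, 0 < δ₀ ∧ 0 < C ∧ ∀ (k : ℕ), 1 ≤ k → ∀ (a m2 : ℝ), amin ≤ a → a ≤ aplus → 0 ≤ m2 → m2 ≤ m2plus →
      ∀ (M M0 : Fin (d + 1) → ℕ) (s : Fin (d + 1) → ℤ) (hs : Fits M M0 s), (∀ i, 1 ≤ M i) →
      ∀ (r : ℕ), 3 ≤ r → ∀ (x : ↥(boxDom (Nf ℓ k M))) (ν : Fin (d + 1)) (x₁' xe₁' x₂' xe₂' : ↥(boxDom (Nf ℓ k M))),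
        xe₁'.1 = x₁'.1 + Pi.single ν 1 → xe₂'.1 = x₂'.1 + Pi.single ν 1 → x₂'.1 ≠ x₁'.1 →
        Margin ((ℓ + 1) ^ k) hs r x → Margin ((ℓ + 1) ^ k) hs r x₁' → Margin ((ℓ + 1) ^ k) hs r x₂' →
        ((((ℓ + 1) ^ k : ℕ) : ℝ) / supNorm (x₂'.1 - x₁'.1)) ^ α *
            (((((ℓ + 1) ^ k : ℕ)) : ℝ) ^ (d + 1) *
              ((((ℓ + 1) ^ k : ℕ) : ℝ) * |(dGk ℓ k hs a m2 x xe₂' - dGk ℓ k hs a m2 x x₂')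
                - (dGk ℓ k hs a m2 x xe₁' - dGk ℓ k hs a m2 x x₁')|))
          ≤ C * Real.exp (-(δ₀ * r)) *
            Real.exp (-(δ₀ * (min (supNorm (x.1 - x₁'.1)) (supNorm (x.1 - x₂'.1)) / ((((ℓ + 1) ^ k : ℕ)) : ℝ)))) := by
  obtain ⟨δ₀, C, hδ₀, hC, h⟩ := abs_dGkDD_le d ℓ hℓ amin aplus m2plus ha hα0 hα1
  refine ⟨δ₀, C, hδ₀, hC, ?_⟩
  intro k hk a m2 h1 h2 h3 h4 M M0 s hs hM r hr x ν x₁' xe₁' x₂' xe₂' hxe₁ hxe₂ hne hx hx₁ hx₂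
  have h' := h k hk a m2 h1 h2 h3 h4 M M0 s hs hM r hr ν x₁' xe₁' x₂' xe₂' hxe₁ hxe₂ hne x hx₁ hx₂ hx
  rw [dGk_comm hs a m2 xe₂' x, dGk_comm hs a m2 x₂' x, dGk_comm hs a m2 xe₁' x, dGk_comm hs a m2 x₁' x,
    supNorm_sub_comm x₁'.1 x.1, supNorm_sub_comm x₂'.1 x.1] at h'
  exact h'

/-- **B3 (2.5), kernel level, MIXED SECOND DIFFERENCE**: for a row bond at `x` and a column bond at `x′`, both of margin `r ≥ 3`,
`(L^k)^{d+1}·(L^k)²·|δG_k(x+e_μ,x′+e_ν) − δG_k(x,x′+e_ν) − δG_k(x+e_μ,x′) + δG_k(x,x′)| ≤ C·e^{−δ₀r}·e^{−δ₀·η|x−x′|_∞}` ((2.10)'s rule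
«for each differentiation an additional factor (L^jη)^{−1}» once in each variable; inputs: the outer box's differenced rows and the
inner box's column-derivative and mixed kernel clauses). [cite: Balaban1983Higgs3, (2.5) p.424] -/
theorem abs_dGkMixed_le (d ℓ : ℕ) (hℓ : 1 ≤ ℓ) (amin aplus m2plus : ℝ) (ha : 0 < amin) :
    ∃ δ₀ C : ℝ, 0 < δ₀ ∧ 0 < C ∧ ∀ (k : ℕ), 1 ≤ k → ∀ (a m2 : ℝ), amin ≤ a → a ≤ aplus → 0 ≤ m2 → m2 ≤ m2plus →
      ∀ (M M0 : Fin (d + 1) → ℕ) (s : Fin (d + 1) → ℤ) (hs : Fits M M0 s), (∀ i, 1 ≤ M i) →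
      ∀ (r : ℕ), 3 ≤ r → ∀ (μ ν : Fin (d + 1)) (x xe : ↥(boxDom (Nf ℓ k M))), xe.1 = x.1 + Pi.single μ 1 →
      ∀ (x' xe' : ↥(boxDom (Nf ℓ k M))), xe'.1 = x'.1 + Pi.single ν 1 →
        Margin ((ℓ + 1) ^ k) hs r x → Margin ((ℓ + 1) ^ k) hs r x' →
        ((((ℓ + 1) ^ k : ℕ)) : ℝ) ^ (d + 1) *
            (((((ℓ + 1) ^ k : ℕ)) : ℝ) ^ 2 * |(dGk ℓ k hs a m2 xe xe' - dGk ℓ k hs a m2 x xe')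
              - (dGk ℓ k hs a m2 xe x' - dGk ℓ k hs a m2 x x')|)
          ≤ C * Real.exp (-(δ₀ * r)) * Real.exp (-(δ₀ * (supNorm (x.1 - x'.1) / ((((ℓ + 1) ^ k : ℕ)) : ℝ)))) := by
  obtain ⟨δa, ca, hδa, hca, hRa⟩ := thm110_zero_box_deriv_roww d ℓ hℓ amin aplus m2plus ha
  obtain ⟨δv, CD', hδv, hCD', hD'⟩ := abs_GkDiff'_sep_le d ℓ hℓ amin aplus m2plus ha (ρ := 1 / 2) (by norm_num)
  obtain ⟨δd, CM, hδd, hCM, hMx⟩ := abs_GkMixed_sep_le d ℓ hℓ amin aplus m2plus ha (ρ := 1 / 2) (by norm_num)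
  set δ : ℝ := min δa (min δv δd) with hδdef
  have hδ : 0 < δ := lt_min hδa (lt_min hδv hδd)
  have la : δ ≤ δa := min_le_left _ _
  have lv : δ ≤ δv := (min_le_right _ _).trans (min_le_left _ _)
  have ld : δ ≤ δd := (min_le_right _ _).trans (min_le_right _ _)
  refine ⟨δ / 2, cCore25 d ca |aplus| δ CD' CM, half_pos hδ, cCore25_pos d hca (abs_nonneg _) hCD'.le hCM, ?_⟩
  intro k hk a m2 h1 h2 h3 h4 M M0 s hs hM r hr μ ν x xe hxe x' xe' hxe' hx hx'
  have hn2 : 2 ≤ (ℓ + 1) ^ k := B4Delta112ZeroBox.two_le_pow hℓ hk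
  have hL := one_lt_L_real hℓ
  have ha0 : 0 < a := ha.trans_le h1
  have hA : 0 < B1.aSeq a ((ℓ : ℝ) + 1) k := B1.aSeq_pos ha0 hL hk
  have hAb : B1.aSeq a ((ℓ : ℝ) + 1) k ≤ |aplus| := ((B1.aSeq_le ha0 hL k hk).trans h2).trans (le_abs_self _)
  have hM0 : ∀ i, 1 ≤ M0 i := fun i => hs.one_le hM i
  have hG : Gfine ℓ k M k a m2 = (boxOpR ((ℓ + 1) ^ k) (B1.aSeq a ((ℓ : ℝ) + 1) k) m2 M)⁻¹ := by
    unfold Gfine; rw [fineOp_top]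
  have hnn : ∀ z : Fin (d + 1) → ℤ, 0 ≤ supNorm z / ((((ℓ + 1) ^ k : ℕ)) : ℝ) := fun z =>
    div_nonneg (supNorm_nonneg _) (Nat.cast_nonneg _)
  have hcore := core_mixed (d := d) hn2 hs hM hA hAb h3 hδ.le hCD'.le hCM.le
    (fun μ y ye hye => wk_row _ _ ((ℓ + 1) ^ k) la (fun y' => supNorm_nonneg _)
      (hRa k hk a m2 h1 h2 h3 h4 M0 hM0 μ y ye hye))
    (fun w ν x' xe' hxe' hsep => by
      rw [← hG]
      exact wk_pt hCD'.le lv (hnn _) (hD' k hk a m2 h1 h2 h3 h4 M hM w ν x' xe' hxe' hsep))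
    (fun μ ν w we hwe x' xe' hxe' hsep => by
      rw [← hG]
      exact wk_pt hCM.le ld (hnn _) (hMx k hk a m2 h1 h2 h3 h4 M hM μ ν w we hwe x' xe' hxe' hsep))
    hr x xe x' xe' hxe hxe' hx hx'
  rw [dGk_eq_dK, dGk_eq_dK, dGk_eq_dK, dGk_eq_dK]
  exact hcore

/-! ## §8 Non-vacuity: a genuinely nested pair with points of margin 3 (`d + 1 = 3`, `L = 2`, `k = 1`, `Ω₂ = 1 + [0,7)³ ⊂ Ω = [0,9)³`,
window `[1,1] × [0,1]`, the fine point `(6,6,6)` of the central unit cube of `Ω₂`) -/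

/-- the nested pair of the witness fits. [folklore] -/
private theorem witness_fits : Fits (fun _ : Fin 3 => 7) (fun _ => 9) (fun _ => (1 : ℤ)) := fun _ => ⟨by norm_num, by norm_num⟩

/-- the fine point `(6,6,6)` of the inner box `[0,14)³` (`n = 2`). [folklore] -/
private theorem witness_mem : (fun _ : Fin 3 => (6 : ℤ)) ∈ boxDom (Nf 1 1 (fun _ : Fin 3 => 7)) := by
  rw [mem_boxDom]; intro i; norm_num

/-- the point `(6,6,6)` has label margin `3`: its unit cube has outer label `(4,4,4)`, the cubes of `Ω∖Ω₂` have a label coordinate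
`0` or `8`. [folklore] -/
private theorem witness_margin : Margin 2 witness_fits 3 ⟨fun _ : Fin 3 => (6 : ℤ), witness_mem⟩ := by
  intro y hy
  have hy2 := mem_boxDom.1 y.2
  rw [mem_boxDom] at hy
  push Not at hy
  obtain ⟨i, hi⟩ := hy
  obtain ⟨h0, h18⟩ := hy2 i
  have h18' : y.1 i < 18 := by simpa using h18
  have hcoord : (blk 2 (emb (witness_fits.scale 2) ⟨fun _ : Fin 3 => (6 : ℤ), witness_mem⟩).1 - blk 2 y.1) i
      = (8 : ℤ) / 2 - y.1 i / 2 := by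
    simp [blk, emb_val]
  have hout : y.1 i < 2 ∨ 16 ≤ y.1 i := by
    by_cases h2 : 0 ≤ y.1 i - 2
    · right
      have := hi (by simpa using h2)
      simp at this
      omega
    · left; omega
  have key : (4 : ℤ) ≤ |(8 : ℤ) / 2 - y.1 i / 2| := by
    rw [le_abs]
    rcases hout with h | h
    · left; omega
    · right; omega
  have h1 : (4 : ℝ) ≤ (((|(blk 2 (emb (witness_fits.scale 2) ⟨fun _ : Fin 3 => (6 : ℤ), witness_mem⟩).1 - blk 2 y.1) i|
      : ℤ)) : ℝ) := by
    rw [hcoord]; exact_mod_cast key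
  have h2 := abs_le_supNorm (blk 2 (emb (witness_fits.scale 2) ⟨fun _ : Fin 3 => (6 : ℤ), witness_mem⟩).1 - blk 2 y.1) i
  have h3 := h1.trans h2
  have h4 : ((3 : ℕ) : ℝ) + 1 = 4 := by norm_num
  rw [h4]
  exact h3

/-- The constants of `abs_dGk_le` exist and the value clause is a genuine inequality at the witness instance (both points the
fine point `(6,6,6)`: coincident arguments are allowed). [cite: Balaban1983Higgs3, (2.5) p.424] -/
theorem abs_dGk_le_witness :
    ∃ δ₀ C : ℝ, 0 < δ₀ ∧ 0 < C ∧
      ((((1 + 1) ^ 1 : ℕ)) : ℝ) ^ (2 + 1) *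
          |dGk 1 1 witness_fits (1 : ℝ) (0 : ℝ) ⟨fun _ : Fin 3 => (6 : ℤ), witness_mem⟩ ⟨fun _ => (6 : ℤ), witness_mem⟩|
        ≤ C * Real.exp (-(δ₀ * (3 : ℕ))) * Real.exp (-(δ₀ * (supNorm ((fun _ : Fin 3 => (6 : ℤ)) - fun _ => (6 : ℤ))
          / ((((1 + 1) ^ 1 : ℕ)) : ℝ)))) := by
  obtain ⟨δ₀, C, hδ₀, hC, h⟩ := abs_dGk_le 2 1 le_rfl 1 1 1 one_pos
  exact ⟨δ₀, C, hδ₀, hC, h 1 le_rfl 1 0 le_rfl le_rfl le_rfl zero_le_one _ _ _ witness_fits (fun _ => by norm_num) 3 le_rfl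
    _ _ witness_margin witness_margin⟩

end

end Literature.MathematicalPhysics.QuantumFieldTheory.Balaban1983to89.B3DeltaGkZeroNest
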